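import Summits.CriticalPhenomena.CardyFormulaZ2.Theses.CardySelfRefinement

/-!
# Disproof of `CriticalPathRSW` — standing adversary's work file (crux stmt-CriticalPhenomena-10267)

Route `CardySelfRefinement`, crux r3 `CriticalPathRSW`: for `k = 2, 3` there is a continuous path
`γ : [0,1] → [0,1]²`, `γ 0 = (1,0)`, `γ 1 = (0,½)`, both coordinates of bounded variation, along which
the self-refinement laws `M_k(γ s)` satisfy the box-crossing bounds (`BoxCrossingBounds`, lower AND
upper) for every aspect ratio with constants uniform in `s`.

## Findings (cycle 1, 2026-08-15; refuter-cdisprove-stmt-CriticalPhenomena-10267-0)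

* `criticalPathRSW_iff` — the crux restated with NAMED pieces (`M`, `PathOK`, `RSWAlong`);
  definitional (`Iff.rfl`), so every lemma below about `PathOK (M k)` is literally about the crux.
  (Pitfall recorded: `ax` must be reducible, otherwise `if ax k e then …` picks the classical
  `Decidable` instance instead of `Int.decidableDvd` and the restatement is no longer defeq.)
* LOAD-BEARING ANALYSIS (the crux is existential, so "drop a requirement" makes it WEAKER):
  - `exists_path_dropContinuous` — without `Continuous γ` the statement follows from RSW at the two
    ENDPOINTS alone (step path). Continuity (the critical locus CONNECTS (1,0) to (0,½)) is the
    entire content; BV, range and endpoint clauses are bookkeeping.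
  - `hasBoxCrossingProperty_endpoints_of_pathOK` — conversely any admissible path forces RSW of
    `M k 1 0` (= bond-kℤ²) and `M k 0 ½` (= bond-ℤ²): the endpoint identifications are necessary.
* SUFFICIENT REDUCTION (what a prover has to produce): `pathOK_of_antitone_criticalCurve` — a
  continuous ANTITONE curve `c⋆ : [0,1] → ℝ` with `c⋆ 1 = 0`, `c⋆ 0 = ½` and box-crossing bounds
  uniform on its graph gives the crux (path `s ↦ (1-s, c⋆(1-s))`; antitone ⇒ BV for free, range
  for free).  Without monotonicity the prover owes `BoundedVariationOn c⋆ (Icc 0 1)` separately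
  (`pathOK_of_bv_criticalCurve`), and a continuous critical curve need NOT be BV a priori.
* MODEL FACTS (single coarse edge; arithmetic only, the identification with `M` is the provers'
  `ExactEndpoints`-type bookkeeping): the law of the `k` sub-edges is
  `μ_ρ(ω) = (1-ρ)2^{-k} + (ρ/2)·[ω constant]`.
  - `blockLaw2_fkg`, `blockLaw3_fkg` — FKG lattice condition for k = 2, 3 (so `M_k` is positively
    associated by Holley/FKG: the KST-2023 hypothesis "positively associated" is available).
  - `allOpen_strictMono`, `someOpen_strictAnti` — P(all k open) = ρ/2+(1-ρ)2^{-k} increases while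
    P(some open) = 1-(all closed) decreases in ρ: NO stochastic order between the block laws at
    ρ < ρ', hence no monotone coupling in ρ — any proof locating the critical curve must work
    with monotonicity in `c` only (`why it might fail` of the planner, made precise).
  - `coarseTransmissivity_lt_half` — on the bottom edge `c = 0` a coarse edge is traversable with
    probability ρ/2+(1-ρ)2^{-k} < ½ for ρ < 1: subcritical bond-kℤ² (the curve leaves (1,0) into
    c > 0; ∂_c of bulk events vanishes at c = 0 because a lone interior edge ends at an isolated
    cell centre — interior edges help only in pairs, c² ~ (1-ρ), the planner's √(1-ρ) law).
* WHY IT RESISTS — a proof ARCHITECTURE rather than an obstruction (paper, this seat; NOTES.md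
  §Mathematics). Let U := {(ρ,c) : ∃ n, P(hard crossing of a 2n×n box) < ε₀} (subcritical, OPEN),
  V := the same for dual crossings (supercritical, OPEN), K := [0,1]² ∖ (U ∪ V) (CLOSED).
  (A) U, V are open (one finite-volume polynomial inequality each); every vertical line meets K
      (bottom edge in U, top edge in V, [0,1] connected); and ON K the box-crossing bounds hold
      at all scales with constants depending on (k, aspect ratio) ONLY (hard crossings ≥ ε₀ both
      ways + FKG gluing; `M_k` is positively associated by `blockLaw2_fkg`/`blockLaw3_fkg` +
      Holley) — so the uniformity in `s` asked by the crux is FREE once γ(s) ∈ K. What is NOT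
      free is the per-point dichotomy "U = subcritical, V = supercritical, U ∩ V = ∅": the
      finite-size criterion propagates smallness of ONE-ARM probabilities for any k-dependent
      model (no symmetry needed: a(9n+k) ≤ 48·a(n)²), but turning "hard crossing < ε₀" into
      "one-arm small" is an RSW statement — Köhler-Schindler–Tassion arXiv:2011.04618 Thm 1
      (p.3: positively associated + invariant under ALL of ℤ² ⋊ D₄; `M_k` has only kℤ² ⋊ D₄ —
      their Comment 1 "same proof for lattices with sufficient symmetries", n ≫ k, unprinted);
      their Thm 3 (p.14, arm-event lower bounds ⇒ long crossings) needs NO invariance at all.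
  (B) Two-sided Aizenman–Grimmett gradient inequality |∂_ρ P_n(A)| ≤ C_k (c(1-c))^{-m} ∂_c P_n(A)
      for increasing cylinder events (local modification: a relevant block can be bypassed
      through a cell centre by two interior edges; no (1-ρ) cost). ⇒ U is invariant under the
      cones (ρ±δ, c-Cδ) and U^c under (ρ±δ, c+Cδ) ⇒ the lower phase boundary
      c_low(ρ) := sup U_ρ is locally LIPSCHITZ on [0,1) (hence continuous and locally BV;
      the elementary cone ⇒ Lipschitz step is `lipschitzOnWith_phaseBoundary_of_cone` below), with
      (ρ, c_low ρ) ∈ K. Sharpness on interior vertical lines is NOT needed: the path may run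
      along ∂U even if K has interior.
  (C) Endpoints by the same inequality inside the two INDEPENDENT endpoint families:
      c_low(0) = ½ (axial-vs-interior comparison in the periodic Bernoulli model + Kesten's
      p_c(ℤ²) = ½ sharpness) and c_low(ρ) → 0 as ρ → 1 (coarse-edge-vs-bridge comparison =
      essential enhancement: Grimmett 1999 Thm (3.16) p.65 [Aizenman–Grimmett 1991; proof gap
      repaired by Balister–Bollobás–Riordan arXiv:1402.0834], here in its 'diminishment' /
      two-parameter form as a gradient inequality, + K closed;
      the compactness step is `tendsto_phaseBoundary_of_isClosed` below).
  (D) BV near ρ = 1, where the constant of (B) degenerates like c^{-m} (c_low → 0): a SIGN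
      lemma ∂_ρ P_n ≥ 0 for c ≤ c₀(k), all n (for k = 2 the ρ-influence of a block is
      ¼·[P(block acts as AND) − P(block acts as OR)]; OR needs an open interior edge at the
      midpoint, so it is O(c) × the same arm event) makes U a down-set in ρ near (1,0), so
      c_low is monotone on [1-δ₀, 1]. CAUTION: BV does NOT follow from (B) alone — a function
      that is L-Lipschitz on every [0,1-δ], positive on [0,1), → 0 at 1, can zigzag at
      amplitude a ≪ r about r/a times on each dyadic block [1-2r,1-r], giving c_low-variation
      ≍ r·a^{α-1} → ∞ after the root c_low = g^{α} (g = c_low^{m+1} is what (B) makes Lipschitz).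
      So for the TWO-sided-Lipschitz route (D) is a genuinely separate input. UPDATE 2026-08-16
      (§8, after crux idea `signed-cone-envelope`): a ONE-sided cone ∂_ρP ≥ -C(1-c)^{-1}∂_cP,
      uniform in ρ and as c → 0, makes c⁻ - Cρ antitone, hence c⁻ BV with no continuity or sign
      input, and vertical segments inside the interval fibres of K supply continuity of the PATH:
      the crux's BV clause has NO teeth either. What keeps teeth is listed in §8.
  (E) `pathOK_of_lipschitz_antitone_criticalCurve` below then assembles the crux's path
      `s ↦ (1-s, c_low(1-s))` (Lean, this file: Lipschitz on [0,1-δ] + antitone on [1-δ,1] ⇒ BV;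
      `boundedVariationOn_Icc_of_lipschitzOn_of_antitoneOn`).
  Every step is a standard technique NOT in print for this model (difficulty L–XL, no open
  problem). A DISPROOF would need (B) or (D) to fail: a block whose influence cannot be
  transferred to interior coins at bounded cost (excluded by the explicit bypass), or K failing
  to reach (1,0)/(0,½) (excluded by (C)). I found no mechanism; the crux is very probably TRUE.
  Monte Carlo (kit job j004938: c⋆_N(ρ) for N = 8…128 coarse cells, k = 2,3, 13 values of ρ, and
  1:1/2:1/3:1 crossing probabilities along it at 4 scales) tests monotonicity of c⋆, the √(1-ρ)
  law and scale-invariance along the curve; numbers are folded in below when the job returns.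
* MC, PRELIMINARY (quick job j004852, done 2026-08-16, N ≤ 16 coarse cells, B = 256–1024; the
  vectorised sampler AGREES with a direct transcription of the crux's `let`-chain on 9×7 / 13×10
  boxes at 4 parameter points per k, |z| ≤ 2.4 — outputs/selfcheck.txt). c⋆_N(ρ) := the c at
  which the aligned N-cell square is crossed with probability ½:
    k = 2: ρ = 0: .475/.493/.498 (N = 4/8/16; → ½ ✓); ρ = .5: .383/.431/.442; ρ = .9: 0/.238/.287;
           ρ = 1: 0/0/0 (P(c=0) ≥ ½ already: critical kℤ² ✓).
    k = 3: ρ = 0: .491/.498/.500; ρ = .5: .435/.451/.458; ρ = .9: 0/.331/.330; ρ = 1: 0.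
  So far: c⋆ DECREASING in ρ on {0, .5, .9, 1} for both k (antitone, as (D)/§8 want); k = 3 sits
  above k = 2; slopes dP/dc at c⋆ grow like N^{0.6–0.85} at ρ ≤ .5 (ν = 4/3 predicts N^{3/4}) but
  are ~0.7–0.9 and NOT yet growing at ρ = .9, N ≤ 16 (wide critical window near (1,0): interior
  edges act at second order) — so c⋆_N(.9) still drifts upward with N. Crossing probabilities AT
  c⋆_16: 2:1 hard-way .156/.164/.167 (k = 2, ρ = 0/.5/.9) and .168 (k = 3, ρ = 0) at height 16
  cells vs the bond-ℤ² row .156 and Cardy's continuum .176; 3:1 hard-way .05–.09 (continuum .042,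
  finite size inflates): RSW-type, ρ-independent within noise — no sign of a first-order point or
  of a critical interval. Full tables (N ≤ 128, 13 values of ρ) pending in j004938 (queued; its
  compute-evidence auto-attaches to the item).
* MC, PHASE DIAGRAM k = 2 (job j004938; the scheduler capped the wall at 0.5 h so the k = 3 half
  was cut off — k = 3 resubmitted as a separate job, see NOTES.md; selfcheck passed). c⋆_N(ρ) for
  N = 8/16/32/64/128 coarse cells (B = 1024–2048 per evaluation, errors 1–7·10⁻⁴ at N ≥ 32):
    ρ = 0 : .4919/.4978/.4994/.4999/.4999   ρ = .1: .4842/.4895/.4918/.4921/.4923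
    ρ = .2: .4739/.4800/.4828/.4835/.4838   ρ = .3: .4614/.4701/.4727/.4732/.4737
    ρ = .4: .4489/.4567/.4609/.4617/.4620   ρ = .5: .4298/.4411/.4460/.4473/.4476
    ρ = .6: .3972/.4222/.4276/.4290/.4297   ρ = .7: .3696/.3984/.4036/.4056/.4061
    ρ = .8: .3330/.3590/.3674/.3713/.3724   ρ = .9: .2259/.2820/.3050/.3095/.3131
    ρ = .95: 0/.2136/.2423/.2458/.2531       ρ = 1: 0 (P(c=0) ≥ ½ already: critical kℤ²).
  (i) The finite-size drift SHRINKS geometrically in N — a converged critical CURVE, not a strip;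
  (ii) c⋆ is STRICTLY DECREASING and smooth/concave in ρ (N = 128: .4999, .4923, .4838, .4737,
  .4620, .4476, .4297, .4061, .3724, .3131, .2531, 0), steepening towards ρ = 1 (c⋆/√(1-ρ) = .83,
  .99, 1.13 at ρ = .8, .9, .95: the √-regime is only asymptotic); (iii) the slope dP_N/dc at c⋆
  doubles per size-doubling by 2^{0.63–0.89}, mean ≈ 2^{0.75} at ρ ≤ .5 — ν = 4/3, the percolation
  thermal exponent, ALONG THE WHOLE CURVE; (iv) crossing probabilities AT (ρ, c⋆_128(ρ)), height
  64 cells, B = 8192: 2:1 hard-way = .175 .180 .174 .178 .170 .179 .179 .185 .177 .175 .174 (ρ = 0,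
  .1, …, .9, .95) and .187 at ρ = 1 (coarse lattice at half the resolution) — ρ-INDEPENDENT within
  ±.005 and equal to Cardy's continuum value .176; 3:1 hard-way .057–.068 (Cardy .042 + finite
  size, same at every ρ); squares .50–.51. So along the entire k = 2 critical curve the model is not
  merely RSW-critical but numerically in the critical-percolation universality class: exactly the
  antitone, continuous, BV, uniformly-RSW path the crux asserts (and what ScaleInvariantLimits /
  TrivialSectorRate ultimately bet on). Analysis file: mc-phase-diagram-j004938-k2-analysis.txt.
* MC, ρ-MONOTONICITY (job j005862, done 2026-08-16, selfcheck passed; B = 4096–8192 per point):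
  P_N(ρ,c) := crossing probability of the aligned N-cell square, scanned in ρ at fixed c.
  Near (1,0): c ∈ {.05,.10,.20}, ρ ∈ {.80,…,1.00} (11 values), N ∈ {16,32,64}, k = 2,3 — P_N is
  STRICTLY INCREASING in ρ in all 18 series, no 3σ decrease anywhere (e.g. k = 3, c = .05, N = 64:
  .0001 → .024 (ρ=.90) → .213 (.96) → .431 (.99) → .509 (1.0); k = 2, c = .20, N = 64: .020 → .621).
  Near (0,½): c ∈ {.45,.50}, ρ ∈ {0,…,.5}, same N, k — again increasing in ρ in all 12 series
  (k = 2, c = .5, N = 32: .513 (ρ=0) → .858 (ρ=.5); k = 3, c = .5, N = 64: .514 → .992).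
  So "tying helps" holds far beyond the sparse regime on these boxes: ideator 1's
  `TyingHelpsSparse` / my sign lemma (D) pass at N ≤ 64, c⋆ is decreasing from ρ = 0 on
  (c⋆'(0) < 0: P_N(ρ,½) > ½ for every ρ > 0), and (1,c) is visibly supercritical for c > 0
  (P_64(1,.2) = .62 and growing with N) — the enhancement endpoint behaves as (C) says.
* THE ENVELOPE PATH IS CHECKED (§9, v7 2026-08-16): `EnvelopePath.exists_path` /
  `pathOK_of_envelope` / `criticalPathRSW_of_envelopes` — a closed `K ⊆ [0,1]²` with interval
  fibres and UNIFORM box-crossing bounds, containing `(0,½)`, `(1,0)` and the graph of a lower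
  envelope `g` with `g - C·ρ` antitone (`C ≥ 0`, `g 0 ≤ ½`) PROVES `CriticalPathRSW` (explicit
  continuous BV path through the completed graph, via the 1-Lipschitz generalised inverse of
  `(C+1)·id - g`). Together with §8 this machine-checks everything soft in the
  `signed-cone-envelope` line; the provers owe percolation only (one-sided cone, two finite-size
  criteria, RSW/KST on K, and `(0,½),(1,0) ∈ K` = endpoint RSW).
* PHASE-SET ASSEMBLY (§10, `criticalPathRSW_of_phases`): the same, fed directly from the two
  OPEN phase sets U (subcritical, down-set) and V (supercritical, up-set): disjointness, the edges,
  `(0,½) ∉ U ∪ V`, `(1,0) ∉ U`, a one-sided cone for U and uniform box-crossing bounds off U ∪ V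
  ⇒ `CriticalPathRSW` (graph of the lower envelope in K by openness of V + disjointness).
* PRODUCT STRUCTURE (§7, `bitPush2_eq_blockLaw2`): the block law is the INCREASING image
  `A ∨ (B ∧ o_e)` of independent bits (p_A = ρ/2, p_B = (1-ρ)/(1-ρ/2), own coins): crossing
  events of `M_k` are increasing events of a PRODUCT measure, so Harris–FKG, BK/Reimer, Russo in
  every parameter, OSSS and Kesten's independent-percolation RSW/arm machinery apply verbatim
  (the only non-standard feature left is the decorated geometry); the ρ-non-monotonicity is
  "p_A ↑, p_B ↓". This removes "dependent FKG family" from the list of obstructions: what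
  remains of the planner's why-might-fail is periodicity kℤ² (vs ℤ²) and non-self-duality.
* GATE LANE (recorded discrepancy): the `Theorems/<Crux>/Negative/…` lane of the cdisprove
  brief does not exist at the gate (targets must be flat `Theorems/<Name>.lean`, and a refuter may
  land only `¬ <Theses decl>`: dry-runs 2026-08-15 bounced `theorems.refuter`); this file therefore
  travels as item EVIDENCE on stmt-CriticalPhenomena-10267 (importable copy: PathLogic.lean in the
  disprover's folder, lint-clean, 398 lines) for a prover to land if wanted.
* Side remark for `TrivialSectorRate` (10266): at (1,0), ∂_cP of a GEOMETRIC quad event is not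
  identically 0 — an interior edge poking through ∂₀Q is pivotal on a half-plane 3-arm event,
  probability ≍ η², so ∂_cP = O(η) → 0; κ(0) = (1,0) still works for θ ≤ 1.
-/

namespace Summit.CriticalPhenomena.CardyFormulaZ2.Cruxes.CriticalPathRSW.Disproof

open scoped BigOperators Topology Manifold Classical MeasureTheory ProbabilityTheory Matrix InnerProductSpace ComplexConjugate ContinuousMap
open Filter Set Function TopologicalSpace MeasureTheory
open Literature.Probability.LatticeModels Literature.Probability.Percolation
open Summit.CriticalPhenomena.CardyFormulaZ2.Theses.CardySelfRefinement (CriticalPathRSW)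

/-! ## 1. The crux with named pieces -/

/-- Axial sub-edges: the edge `(v, d)` (from `v` in direction `d`) lies on a line of `kℤ²`
(`abbrev`, so that `if ax k e then …` finds `Int.decidableDvd` exactly as the crux's `let` does). -/
abbrev ax (k : ℕ) (e : Site 2 × Fin 2) : Prop := (k : ℤ) ∣ e.1 (if e.2 = 0 then 1 else 0)

/-- Coarse block of an edge (coordinatewise Euclidean division = floor for `k > 0`). -/
def tb (k : ℕ) (e : Site 2 × Fin 2) : Site 2 := fun i => e.1 i / (k : ℤ)

/-- Open-ness of the edge `(v, d)` given the coin set `S`: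
selector ∧ shared coin, or ¬selector ∧ own coin, on axial edges; own coin off-axis. -/
def opn (k : ℕ) (S : Set (Site 2 × Fin 2 × Fin 3)) (e : Site 2 × Fin 2) : Prop :=
  if ax k e then ((tb k e, e.2, (2 : Fin 3)) ∈ S ∧ (tb k e, e.2, (1 : Fin 3)) ∈ S) ∨
    ((tb k e, e.2, (2 : Fin 3)) ∉ S ∧ (e.1, e.2, (0 : Fin 3)) ∈ S)
  else (e.1, e.2, (0 : Fin 3)) ∈ S

/-- The bond configuration induced by the coin set `S`. -/
def cfg (k : ℕ) (S : Set (Site 2 × Fin 2 × Fin 3)) : BondConfig (Site 2) :=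
  {e | ∃ (v : Site 2) (d : Fin 2), e = s(v, v + (if d = 0 then ![1, 0] else ![0, 1])) ∧ opn k S (v, d)}

/-- Coin parameters of `M_k(ρ,c)`: own coin ½ on axial edges / `c` off-axis (type 0), shared
fair coin (type 1), selector `ρ` (type 2). -/
noncomputable def prm (k : ℕ) (ρ c : ℝ) (i : Site 2 × Fin 2 × Fin 3) : unitInterval :=
  if i.2.2 = 0 then (if ax k (i.1, i.2.1) then half else Set.projIcc (0 : ℝ) 1 zero_le_one c)
  else if i.2.2 = 1 then half else Set.projIcc (0 : ℝ) 1 zero_le_one ρ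

/-- The self-refinement law `M_k(ρ,c)` exactly as inlined in the crux. -/
noncomputable def M (k : ℕ) (ρ c : ℝ) : Measure (BondConfig (Site 2)) :=
  (prodBernoulli (prm k ρ c)).map (cfg k)

/-- Uniform box-crossing bounds along a parameter path, for a general two-parameter family. -/
def RSWAlong (μ : ℝ → ℝ → Measure (BondConfig (Site 2))) (γ : unitInterval → ℝ × ℝ) : Prop :=
  ∀ a : ℝ, 0 < a → ∃ c₀ > 0, ∃ n₀ : ℕ, ∀ s,
    BoxCrossingBounds (μ (γ s).1 (γ s).2) squareLatticeEmbedding.z a c₀ n₀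

/-- The path requirements of the crux without continuity, for a general two-parameter family. -/
def PathOKNoCont (μ : ℝ → ℝ → Measure (BondConfig (Site 2))) (γ : unitInterval → ℝ × ℝ) : Prop :=
  γ 0 = (1, 0) ∧ γ 1 = (0, 1 / 2) ∧ (∀ s, γ s ∈ Set.Icc (0 : ℝ) 1 ×ˢ Set.Icc (0 : ℝ) 1) ∧
    BoundedVariationOn (fun s => (γ s).1) Set.univ ∧ BoundedVariationOn (fun s => (γ s).2) Set.univ ∧
    RSWAlong μ γ

/-- The path requirements of the crux, for a general two-parameter family. -/
def PathOK (μ : ℝ → ℝ → Measure (BondConfig (Site 2))) (γ : unitInterval → ℝ × ℝ) : Prop :=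
  Continuous γ ∧ γ 0 = (1, 0) ∧ γ 1 = (0, 1 / 2) ∧ (∀ s, γ s ∈ Set.Icc (0 : ℝ) 1 ×ˢ Set.Icc (0 : ℝ) 1) ∧
    BoundedVariationOn (fun s => (γ s).1) Set.univ ∧ BoundedVariationOn (fun s => (γ s).2) Set.univ ∧
    RSWAlong μ γ

theorem pathOK_iff_continuous_and_noCont (μ : ℝ → ℝ → Measure (BondConfig (Site 2)))
    (γ : unitInterval → ℝ × ℝ) : PathOK μ γ ↔ Continuous γ ∧ PathOKNoCont μ γ :=
  Iff.rfl

/-- The crux, restated with named pieces (definitional). -/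
theorem criticalPathRSW_iff :
    CriticalPathRSW ↔ ∀ k : ℕ, k = 2 ∨ k = 3 → ∃ γ : unitInterval → ℝ × ℝ, PathOK (M k) γ :=
  Iff.rfl

/-! ## 2. Bookkeeping lemmas -/

/-- Box-crossing bounds weaken monotonically in the constants. -/
theorem boxCrossingBounds_mono {V : Type*} {μ : Measure (BondConfig V)} {z : V → ℂ} {a c c' : ℝ}
    {n₀ n₀' : ℕ} (h : BoxCrossingBounds μ z a c n₀) (hc : c' ≤ c) (hn : n₀ ≤ n₀') :
    BoxCrossingBounds μ z a c' n₀' := by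
  intro n hn' w
  obtain ⟨⟨h1, h2⟩, h3, h4⟩ := h n (hn.trans hn') w
  exact ⟨⟨hc.trans h1, h2.trans (by linarith)⟩, hc.trans h3, h4.trans (by linarith)⟩

/-- A bounded antitone real function has bounded variation (order-dual of
`MonotoneOn.boundedVariationOn`). -/
theorem antitoneOn_boundedVariationOn {α : Type*} [LinearOrder α] {f : α → ℝ} {s : Set α} {C : ℝ}
    (hf : AntitoneOn f s) (h : ∀ x ∈ s, |f x| ≤ C) : BoundedVariationOn f s := by
  have hm : MonotoneOn (f ∘ OrderDual.ofDual) (OrderDual.ofDual ⁻¹' s) :=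
    fun x hx y hy hxy => hf hy hx hxy
  have hb : BoundedVariationOn (f ∘ OrderDual.ofDual) (OrderDual.ofDual ⁻¹' s) :=
    hm.boundedVariationOn (C := C) fun x hx => h _ hx
  simpa [BoundedVariationOn, eVariationOn.comp_ofDual] using hb

theorem unitInterval_zero_ne_one : (0 : unitInterval) ≠ 1 := by
  intro h
  have := congrArg Subtype.val h
  norm_num at this

/-! ## 3. Load-bearing analysis -/

/-- WITHOUT CONTINUITY the crux is just RSW at the two endpoints: the step path
`γ s = (1,0)` for `s < 1`, `γ 1 = (0,½)` meets every other clause. So `Continuous γ` carries the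
entire content of `CriticalPathRSW` (the critical locus must CONNECT (1,0) to (0,½)). -/
theorem exists_path_dropContinuous (μ : ℝ → ℝ → Measure (BondConfig (Site 2)))
    (h0 : HasBoxCrossingProperty (μ 1 0) squareLatticeEmbedding.z)
    (h1 : HasBoxCrossingProperty (μ 0 (1 / 2)) squareLatticeEmbedding.z) :
    ∃ γ : unitInterval → ℝ × ℝ, PathOKNoCont μ γ := by
  classical
  refine ⟨fun s => if s = 1 then (0, 1 / 2) else (1, 0), ?_, ?_, ?_, ?_, ?_, ?_⟩
  · simp
  · simp
  · intro s
    by_cases hs : s = 1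
    · simp only [hs, if_true]; norm_num
    · simp only [hs, if_false]; norm_num
  · -- first coordinate: antitone step function
    refine antitoneOn_boundedVariationOn (C := 1) ?_ ?_
    · intro s _ t _ hst
      by_cases hs : s = 1
      · have ht : t = 1 := le_antisymm unitInterval.le_one' (hs ▸ hst)
        simp [hs, ht]
      · by_cases ht : t = 1 <;> simp [hs, ht]
    · intro s _
      by_cases hs : s = 1 <;> simp [hs]
  · -- second coordinate: monotone step function
    refine MonotoneOn.boundedVariationOn (C := 1) ?_ ?_
    · intro s _ t _ hst
      by_cases hs : s = 1
      · have ht : t = 1 := le_antisymm unitInterval.le_one' (hs ▸ hst)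
        simp [hs, ht]
      · by_cases ht : t = 1 <;> simp [hs, ht]
    · intro s _
      by_cases hs : s = 1
      · simp only [hs, if_true]; norm_num
      · simp only [hs, if_false]; norm_num
  · intro a ha
    obtain ⟨c₀, hc₀, n₀, H0⟩ := h0 a ha
    obtain ⟨c₁, hc₁, n₁, H1⟩ := h1 a ha
    refine ⟨min c₀ c₁, lt_min hc₀ hc₁, max n₀ n₁, fun s => ?_⟩
    by_cases hs : s = 1
    · simpa [hs] using boxCrossingBounds_mono H1 (min_le_right _ _) (le_max_right _ _)
    · simpa [hs] using boxCrossingBounds_mono H0 (min_le_left _ _) (le_max_left _ _)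

/-- Conversely, ANY admissible path (continuous or not) forces RSW at both endpoints:
`M k 1 0` (bond-kℤ² drawn on the fine lattice) and `M k 0 ½` (bond-ℤ²). -/
theorem hasBoxCrossingProperty_endpoints_of_noCont {μ : ℝ → ℝ → Measure (BondConfig (Site 2))}
    {γ : unitInterval → ℝ × ℝ} (h : PathOKNoCont μ γ) :
    HasBoxCrossingProperty (μ 1 0) squareLatticeEmbedding.z ∧
      HasBoxCrossingProperty (μ 0 (1 / 2)) squareLatticeEmbedding.z := by
  obtain ⟨h0, h1, -, -, -, hR⟩ := h
  constructor
  · intro a ha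
    obtain ⟨c₀, hc₀, n₀, H⟩ := hR a ha
    exact ⟨c₀, hc₀, n₀, by simpa [h0] using H 0⟩
  · intro a ha
    obtain ⟨c₀, hc₀, n₀, H⟩ := hR a ha
    exact ⟨c₀, hc₀, n₀, by simpa [h1] using H 1⟩

/-- `CriticalPathRSW` minus continuity is EQUIVALENT to RSW at the two endpoint models. -/
theorem exists_noCont_iff_endpoints (μ : ℝ → ℝ → Measure (BondConfig (Site 2))) :
    (∃ γ, PathOKNoCont μ γ) ↔
      HasBoxCrossingProperty (μ 1 0) squareLatticeEmbedding.z ∧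
        HasBoxCrossingProperty (μ 0 (1 / 2)) squareLatticeEmbedding.z :=
  ⟨fun ⟨_, h⟩ => hasBoxCrossingProperty_endpoints_of_noCont h,
    fun h => exists_path_dropContinuous μ h.1 h.2⟩

/-! ## 4. What suffices: a continuous critical curve -/

/-- SUFFICIENT REDUCTION. A continuous antitone "critical curve" `c⋆` on `[0,1]` with
`c⋆ 1 = 0`, `c⋆ 0 = ½`, carrying box-crossing bounds uniform over its graph, yields the crux's
path (`s ↦ (1 - s, c⋆ (1 - s))`): antitone gives bounded variation and the range for free. -/
theorem pathOK_of_antitone_criticalCurve (μ : ℝ → ℝ → Measure (BondConfig (Site 2)))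
    (cstar : ℝ → ℝ) (hcont : ContinuousOn cstar (Set.Icc 0 1)) (hanti : AntitoneOn cstar (Set.Icc 0 1))
    (h1 : cstar 1 = 0) (h0 : cstar 0 = 1 / 2)
    (hRSW : ∀ a : ℝ, 0 < a → ∃ c₀ > 0, ∃ n₀ : ℕ, ∀ ρ ∈ Set.Icc (0 : ℝ) 1,
      BoxCrossingBounds (μ ρ (cstar ρ)) squareLatticeEmbedding.z a c₀ n₀) :
    ∃ γ : unitInterval → ℝ × ℝ, PathOK μ γ := by
  have hmem : ∀ s : unitInterval, ((unitInterval.symm s : ℝ)) ∈ Set.Icc (0 : ℝ) 1 :=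
    fun s => (unitInterval.symm s).2
  have hlo : ∀ x ∈ Set.Icc (0 : ℝ) 1, 0 ≤ cstar x := fun x hx => by
    have := hanti hx ⟨zero_le_one, le_rfl⟩ hx.2
    simpa [h1] using this
  have hhi : ∀ x ∈ Set.Icc (0 : ℝ) 1, cstar x ≤ 1 / 2 := fun x hx => by
    have := hanti ⟨le_rfl, zero_le_one⟩ hx hx.1
    simpa [h0] using this
  refine ⟨fun s => ((unitInterval.symm s : ℝ), cstar (unitInterval.symm s)), ?_, ?_, ?_, ?_, ?_, ?_, ?_⟩
  · refine Continuous.prodMk ?_ ?_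
    · exact continuous_subtype_val.comp unitInterval.continuous_symm
    · exact hcont.comp_continuous (continuous_subtype_val.comp unitInterval.continuous_symm) hmem
  · simp [h1]
  · simp [h0]
  · intro s
    refine ⟨hmem s, hlo _ (hmem s), (hhi _ (hmem s)).trans (by norm_num)⟩
  · refine antitoneOn_boundedVariationOn (C := 1) ?_ ?_
    · intro s _ t _ hst
      exact Subtype.coe_le_coe.mpr (unitInterval.symm_le_symm.mpr hst)
    · intro s _
      rw [abs_of_nonneg (hmem s).1]
      exact (hmem s).2
  · refine MonotoneOn.boundedVariationOn (C := 1 / 2) ?_ ?_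
    · intro s _ t _ hst
      exact hanti (hmem t) (hmem s) (Subtype.coe_le_coe.mpr (unitInterval.symm_le_symm.mpr hst))
    · intro s _
      rw [abs_of_nonneg (hlo _ (hmem s))]
      exact hhi _ (hmem s)
  · intro a ha
    obtain ⟨c₀, hc₀, n₀, H⟩ := hRSW a ha
    exact ⟨c₀, hc₀, n₀, fun s => H _ (hmem s)⟩

/-- The same reduction with bounded variation of `c⋆` as an explicit hypothesis instead of
monotonicity (a continuous critical curve need not be BV a priori; this is what is owed then). -/
theorem pathOK_of_bv_criticalCurve (μ : ℝ → ℝ → Measure (BondConfig (Site 2)))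
    (cstar : ℝ → ℝ) (hcont : ContinuousOn cstar (Set.Icc 0 1))
    (hbv : BoundedVariationOn cstar (Set.Icc 0 1)) (hrange : Set.MapsTo cstar (Set.Icc 0 1) (Set.Icc 0 1))
    (h1 : cstar 1 = 0) (h0 : cstar 0 = 1 / 2)
    (hRSW : ∀ a : ℝ, 0 < a → ∃ c₀ > 0, ∃ n₀ : ℕ, ∀ ρ ∈ Set.Icc (0 : ℝ) 1,
      BoxCrossingBounds (μ ρ (cstar ρ)) squareLatticeEmbedding.z a c₀ n₀) :
    ∃ γ : unitInterval → ℝ × ℝ, PathOK μ γ := by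
  have hmem : ∀ s : unitInterval, ((unitInterval.symm s : ℝ)) ∈ Set.Icc (0 : ℝ) 1 :=
    fun s => (unitInterval.symm s).2
  refine ⟨fun s => ((unitInterval.symm s : ℝ), cstar (unitInterval.symm s)), ?_, ?_, ?_, ?_, ?_, ?_, ?_⟩
  · refine Continuous.prodMk ?_ ?_
    · exact continuous_subtype_val.comp unitInterval.continuous_symm
    · exact hcont.comp_continuous (continuous_subtype_val.comp unitInterval.continuous_symm) hmem
  · simp [h1]
  · simp [h0]
  · intro s
    exact ⟨hmem s, hrange (hmem s)⟩
  · refine antitoneOn_boundedVariationOn (C := 1) ?_ ?_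
    · intro s _ t _ hst
      exact Subtype.coe_le_coe.mpr (unitInterval.symm_le_symm.mpr hst)
    · intro s _
      rw [abs_of_nonneg (hmem s).1]
      exact (hmem s).2
  · -- BV is preserved by the antitone reparametrisation `s ↦ 1 - s`
    have hφ : AntitoneOn (fun s : unitInterval => ((unitInterval.symm s : ℝ))) Set.univ :=
      fun s _ t _ hst => Subtype.coe_le_coe.mpr (unitInterval.symm_le_symm.mpr hst)
    have himg : (fun s : unitInterval => ((unitInterval.symm s : ℝ))) '' Set.univ ⊆ Set.Icc 0 1 := by
      rintro _ ⟨s, -, rfl⟩; exact hmem s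
    have key := eVariationOn.comp_eq_of_antitoneOn cstar (fun s : unitInterval => ((unitInterval.symm s : ℝ))) hφ
    change eVariationOn (cstar ∘ fun s : unitInterval => ((unitInterval.symm s : ℝ))) Set.univ ≠ ⊤
    rw [key]
    exact ne_top_of_le_ne_top hbv (eVariationOn.mono cstar himg)
  · intro a ha
    obtain ⟨c₀, hc₀, n₀, H⟩ := hRSW a ha
    exact ⟨c₀, hc₀, n₀, fun s => H _ (hmem s)⟩

/-- Specialisation to the crux: continuous antitone critical curves for `k = 2, 3` with uniform
box-crossing bounds on their graphs prove `CriticalPathRSW`. (The provers' target shape.) -/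
theorem criticalPathRSW_of_antitone_criticalCurves
    (h : ∀ k : ℕ, k = 2 ∨ k = 3 → ∃ cstar : ℝ → ℝ, ContinuousOn cstar (Set.Icc 0 1) ∧
      AntitoneOn cstar (Set.Icc 0 1) ∧ cstar 1 = 0 ∧ cstar 0 = 1 / 2 ∧
      ∀ a : ℝ, 0 < a → ∃ c₀ > 0, ∃ n₀ : ℕ, ∀ ρ ∈ Set.Icc (0 : ℝ) 1,
        BoxCrossingBounds (M k ρ (cstar ρ)) squareLatticeEmbedding.z a c₀ n₀) :
    CriticalPathRSW := by
  rw [criticalPathRSW_iff]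
  intro k hk
  obtain ⟨cstar, hc, ha, h1, h0, hR⟩ := h k hk
  exact pathOK_of_antitone_criticalCurve (M k) cstar hc ha h1 h0 hR

/-- Bounded variation on `[0,1]` from the shape delivered by the gradient-inequality
architecture ((B)+(D) of the module docstring): Lipschitz on `[0, 1-δ]`, antitone and bounded
on `[1-δ, 1]`. -/
theorem boundedVariationOn_Icc_of_lipschitzOn_of_antitoneOn {f : ℝ → ℝ} {δ : ℝ} {C : NNReal}
    {B : ℝ} (hδ0 : 0 < δ) (hδ1 : δ < 1)
    (hlip : LipschitzOnWith C f (Set.Icc 0 (1 - δ)))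
    (hanti : AntitoneOn f (Set.Icc (1 - δ) 1)) (hbdd : ∀ x ∈ Set.Icc (1 - δ) 1, |f x| ≤ B) :
    BoundedVariationOn f (Set.Icc 0 1) := by
  have h1 : BoundedVariationOn f (Set.Icc 0 (1 - δ)) := by
    have := hlip.locallyBoundedVariationOn 0 (1 - δ) ⟨le_rfl, by linarith⟩ ⟨by linarith, le_rfl⟩
    simpa [Set.inter_self] using this
  have h2 : BoundedVariationOn f (Set.Icc (1 - δ) 1) := antitoneOn_boundedVariationOn hanti hbdd
  have hunion : Set.Icc (0 : ℝ) 1 = Set.Icc 0 (1 - δ) ∪ Set.Icc (1 - δ) 1 :=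
    (Set.Icc_union_Icc_eq_Icc (by linarith) (by linarith)).symm
  have hG : IsGreatest (Set.Icc (0 : ℝ) (1 - δ)) (1 - δ) := ⟨⟨by linarith, le_rfl⟩, fun y hy => hy.2⟩
  have hL : IsLeast (Set.Icc (1 - δ) (1 : ℝ)) (1 - δ) := ⟨⟨le_rfl, by linarith⟩, fun y hy => hy.1⟩
  rw [BoundedVariationOn, hunion, eVariationOn.union f hG hL]
  exact ENNReal.add_ne_top.mpr ⟨h1, h2⟩

/-- The provers' target shape under the gradient-inequality architecture: a continuous lower
phase boundary `c_low` that is Lipschitz away from `ρ = 1` ((B)), antitone near `ρ = 1` ((D)),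
with the right endpoints ((C)) and box-crossing bounds uniform on its graph ((A)). -/
theorem pathOK_of_lipschitz_antitone_criticalCurve (μ : ℝ → ℝ → Measure (BondConfig (Site 2)))
    (clow : ℝ → ℝ) (hcont : ContinuousOn clow (Set.Icc 0 1))
    (hrange : Set.MapsTo clow (Set.Icc 0 1) (Set.Icc 0 1))
    {δ : ℝ} {C : NNReal} (hδ0 : 0 < δ) (hδ1 : δ < 1)
    (hlip : LipschitzOnWith C clow (Set.Icc 0 (1 - δ)))
    (hanti : AntitoneOn clow (Set.Icc (1 - δ) 1))
    (h1 : clow 1 = 0) (h0 : clow 0 = 1 / 2)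
    (hRSW : ∀ a : ℝ, 0 < a → ∃ c₀ > 0, ∃ n₀ : ℕ, ∀ ρ ∈ Set.Icc (0 : ℝ) 1,
      BoxCrossingBounds (μ ρ (clow ρ)) squareLatticeEmbedding.z a c₀ n₀) :
    ∃ γ : unitInterval → ℝ × ℝ, PathOK μ γ := by
  refine pathOK_of_bv_criticalCurve μ clow hcont ?_ hrange h1 h0 hRSW
  refine boundedVariationOn_Icc_of_lipschitzOn_of_antitoneOn (B := 1) hδ0 hδ1 hlip hanti ?_
  intro x hx
  have hx' : x ∈ Set.Icc (0 : ℝ) 1 := ⟨by linarith [hx.1], hx.2⟩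
  rw [abs_of_nonneg (hrange hx').1]
  exact (hrange hx').2

/-! ## 5. Single-block facts: FKG, no monotone coupling in ρ, subcritical bottom edge -/

/-- Law of the two sub-edges of one coarse edge under `M_2(ρ,·)` (states `a b : Bool`):
i.i.d. fair with probability `1-ρ`, one shared fair coin with probability `ρ`. -/
noncomputable def blockLaw2 (ρ : ℝ) (a b : Bool) : ℝ := (1 - ρ) / 4 + if a = b then ρ / 2 else 0

/-- Law of the three sub-edges of one coarse edge under `M_3(ρ,·)`. -/
noncomputable def blockLaw3 (ρ : ℝ) (a b e : Bool) : ℝ :=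
  (1 - ρ) / 8 + if a = b ∧ b = e then ρ / 2 else 0

theorem blockLaw2_sum (ρ : ℝ) :
    blockLaw2 ρ true true + blockLaw2 ρ true false + blockLaw2 ρ false true + blockLaw2 ρ false false = 1 := by
  simp [blockLaw2]; ring

theorem blockLaw3_sum (ρ : ℝ) :
    blockLaw3 ρ true true true + blockLaw3 ρ true true false + blockLaw3 ρ true false true +
      blockLaw3 ρ true false false + blockLaw3 ρ false true true + blockLaw3 ρ false true false +
      blockLaw3 ρ false false true + blockLaw3 ρ false false false = 1 := by
  simp [blockLaw3]; ring

/-- FKG lattice condition for the 2-block law, `0 ≤ ρ` (hence, with the product structure,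
positive association of `M_2(ρ,c)` by the FKG theorem). -/
theorem blockLaw2_fkg {ρ : ℝ} (h0 : 0 ≤ ρ) (a b a' b' : Bool) :
    blockLaw2 ρ a b * blockLaw2 ρ a' b' ≤
      blockLaw2 ρ (a || a') (b || b') * blockLaw2 ρ (a && a') (b && b') := by
  cases a <;> cases b <;> cases a' <;> cases b' <;> simp [blockLaw2] <;> nlinarith

/-- FKG lattice condition for the 3-block law, `0 ≤ ρ ≤ 1`. -/
theorem blockLaw3_fkg {ρ : ℝ} (h0 : 0 ≤ ρ) (h1 : ρ ≤ 1) (a b e a' b' e' : Bool) :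
    blockLaw3 ρ a b e * blockLaw3 ρ a' b' e' ≤
      blockLaw3 ρ (a || a') (b || b') (e || e') * blockLaw3 ρ (a && a') (b && b') (e && e') := by
  cases a <;> cases b <;> cases e <;> cases a' <;> cases b' <;> cases e' <;>
    simp [blockLaw3] <;> nlinarith

/-- Probability that all `k` sub-edges of a coarse edge are open (the coarse edge is
traversable): `ρ/2 + (1-ρ)/2^k`. -/
noncomputable def allOpen (k : ℕ) (ρ : ℝ) : ℝ := ρ / 2 + (1 - ρ) / 2 ^ k

/-- Probability that some sub-edge of a coarse edge is open: `1 - (all closed)`. -/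
noncomputable def someOpen (k : ℕ) (ρ : ℝ) : ℝ := 1 - (ρ / 2 + (1 - ρ) / 2 ^ k)

theorem allOpen_two_eq (ρ : ℝ) : allOpen 2 ρ = blockLaw2 ρ true true := by
  simp [allOpen, blockLaw2]; ring

theorem someOpen_two_eq (ρ : ℝ) : someOpen 2 ρ = 1 - blockLaw2 ρ false false := by
  simp [someOpen, blockLaw2]; ring

theorem allOpen_three_eq (ρ : ℝ) : allOpen 3 ρ = blockLaw3 ρ true true true := by
  simp [allOpen, blockLaw3]; ring

/-- NO MONOTONE COUPLING IN ρ (k ≥ 2): the increasing event "all sub-edges open" becomes MORE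
likely as ρ grows … -/
theorem allOpen_strictMono {k : ℕ} (hk : 2 ≤ k) : StrictMono (allOpen k) := by
  intro ρ ρ' h
  have h2 : (4 : ℝ) ≤ 2 ^ k := by
    calc (4 : ℝ) = 2 ^ 2 := by norm_num
      _ ≤ 2 ^ k := pow_le_pow_right₀ (by norm_num) hk
  have hpos : (0 : ℝ) < 2 ^ k := by positivity
  unfold allOpen
  rw [div_add_div _ _ (two_ne_zero) hpos.ne', div_add_div _ _ (two_ne_zero) hpos.ne',
    div_lt_div_iff_of_pos_right (by positivity)]
  nlinarith

/-- … while the increasing event "some sub-edge open" becomes LESS likely: the block laws at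
ρ < ρ' are not stochastically ordered either way, so `M_k(ρ,c)` admits no monotone coupling in ρ
and the critical curve cannot be located by ρ-monotonicity (only c-monotonicity is available). -/
theorem someOpen_strictAnti {k : ℕ} (hk : 2 ≤ k) : StrictAnti (someOpen k) := by
  intro ρ ρ' h
  have := allOpen_strictMono hk h
  unfold someOpen; unfold allOpen at this
  linarith

/-- On the bottom edge `c = 0` a coarse edge is traversable with probability `allOpen k ρ`,
which is `< ½ = p_c(bond kℤ²)` exactly when `ρ < 1` (k ≥ 2): the segment {c = 0, ρ < 1} is
subcritical and the critical curve leaves (1,0) into `c > 0`. -/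
theorem coarseTransmissivity_lt_half {k : ℕ} (hk : 2 ≤ k) {ρ : ℝ} (hρ : ρ < 1) :
    allOpen k ρ < 1 / 2 := by
  have := allOpen_strictMono hk hρ
  have h1 : allOpen k 1 = 1 / 2 := by simp [allOpen]
  simpa [h1] using this

theorem coarseTransmissivity_eq_half_iff {k : ℕ} (hk : 2 ≤ k) {ρ : ℝ} :
    allOpen k ρ = 1 / 2 ↔ ρ = 1 := by
  constructor
  · intro h
    by_contra hne
    rcases lt_or_gt_of_ne hne with hlt | hgt
    · exact (coarseTransmissivity_lt_half hk hlt).ne h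
    · have := allOpen_strictMono hk hgt
      have h1 : allOpen k 1 = 1 / 2 := by simp [allOpen]
      rw [h1, h] at this
      exact lt_irrefl _ this
  · rintro rfl; simp [allOpen]


/-! ## 6. The elementary steps of the architecture: (B) ⇒ Lipschitz, (C) ⇒ endpoint continuity, (D) ⇒ antitone -/

/-- CONE INVARIANCE ⇒ LIPSCHITZ PHASE BOUNDARY. If the subcritical set `U ⊆ ℝ²` is invariant under
the down-cones `(ρ, c) ↦ (ρ', c - C|ρ'-ρ|)` and its complement under the up-cones (this is what
the two-sided gradient inequality `|∂_ρ P_n| ≤ C ∂_c P_n` gives, scale by scale), and every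
vertical line over `I` enters `U` at height `a`, then the lower phase boundary
`c_low ρ := sSup {c ≤ b | (ρ, c) ∈ U}` is `C`-Lipschitz on `I`. (Elementary; the analytic
content is entirely in establishing the cone invariance.) -/
theorem lipschitzOnWith_phaseBoundary_of_cone {U : Set (ℝ × ℝ)} {I : Set ℝ} {C : NNReal}
    {a b : ℝ} (hab : a ≤ b) (hbot : ∀ ρ ∈ I, (ρ, a) ∈ U)
    (hcone : ∀ ρ ∈ I, ∀ ρ' ∈ I, ∀ c, (ρ, c) ∈ U → (ρ', c - C * |ρ' - ρ|) ∈ U)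
    (hcone' : ∀ ρ ∈ I, ∀ ρ' ∈ I, ∀ c, (ρ, c) ∉ U → (ρ', c + C * |ρ' - ρ|) ∉ U) :
    LipschitzOnWith C (fun ρ => sSup {c | c ≤ b ∧ (ρ, c) ∈ U}) I := by
  have hne : ∀ ρ ∈ I, ({c | c ≤ b ∧ (ρ, c) ∈ U} : Set ℝ).Nonempty :=
    fun ρ hρ => ⟨a, hab, hbot ρ hρ⟩
  have hbdd : ∀ ρ, BddAbove ({c | c ≤ b ∧ (ρ, c) ∈ U} : Set ℝ) := fun ρ => ⟨b, fun c hc => hc.1⟩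
  have key : ∀ ρ ∈ I, ∀ ρ' ∈ I,
      sSup {c | c ≤ b ∧ (ρ, c) ∈ U} - C * |ρ' - ρ| ≤ sSup {c | c ≤ b ∧ (ρ', c) ∈ U} := by
    intro ρ hρ ρ' hρ'
    rw [sub_le_iff_le_add]
    refine csSup_le (hne ρ hρ) ?_
    intro c hc
    have hC : 0 ≤ (C : ℝ) * |ρ' - ρ| := by positivity
    have h1 : (ρ', c - C * |ρ' - ρ|) ∈ U := hcone ρ hρ ρ' hρ' c hc.2
    have h2 : c - C * |ρ' - ρ| ≤ sSup {c | c ≤ b ∧ (ρ', c) ∈ U} :=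
      le_csSup (hbdd ρ') ⟨by linarith [hc.1], h1⟩
    linarith
  have key' : ∀ ρ ∈ I, ∀ ρ' ∈ I,
      sSup {c | c ≤ b ∧ (ρ', c) ∈ U} ≤ sSup {c | c ≤ b ∧ (ρ, c) ∈ U} + C * |ρ' - ρ| := by
    intro ρ hρ ρ' hρ'
    refine csSup_le (hne ρ' hρ') ?_
    intro c hc
    by_contra hlt
    have hlt := lt_of_not_ge hlt
    have hC : 0 ≤ (C : ℝ) * |ρ' - ρ| := by positivity
    have hnot : (ρ, c - C * |ρ' - ρ|) ∉ U := by
      intro hin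
      have : c - C * |ρ' - ρ| ≤ sSup {c | c ≤ b ∧ (ρ, c) ∈ U} :=
        le_csSup (hbdd ρ) ⟨by linarith [hc.1], hin⟩
      linarith
    have := hcone' ρ hρ ρ' hρ' _ hnot
    simp only [sub_add_cancel] at this
    exact this hc.2
  refine LipschitzOnWith.of_dist_le_mul fun ρ hρ ρ' hρ' => ?_
  rw [Real.dist_eq, Real.dist_eq, abs_sub_le_iff]
  have e1 := key ρ' hρ' ρ hρ
  have e2 := key' ρ' hρ' ρ hρ
  constructor <;> linarith

/-- CLOSED CRITICAL SET ⇒ CONTINUITY OF THE PHASE BOUNDARY AT THE ENDPOINT (step (C)): if the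
graph of a bounded `f` eventually lies in a closed set `K` along a filter `l` tending to `ρ₁`, and
`K` meets the vertical line `{ρ₁} × ℝ` only at height `c₁`, then `f → c₁` along `l`
(compactness + uniqueness of the cluster value). Used with `K` = the RSW-critical set,
`ρ₁ = 1, c₁ = 0` (essential enhancement) and `ρ₁ = 0, c₁ = ½` (Kesten). -/
theorem tendsto_phaseBoundary_of_isClosed {K : Set (ℝ × ℝ)} (hK : IsClosed K) {f : ℝ → ℝ}
    {B ρ₁ c₁ : ℝ} {l : Filter ℝ} (hl : Tendsto id l (𝓝 ρ₁)) (hf : ∀ᶠ ρ in l, (ρ, f ρ) ∈ K)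
    (hbdd : ∀ᶠ ρ in l, f ρ ∈ Set.Icc (-B) B) (h1 : ∀ c, (ρ₁, c) ∈ K → c = c₁) :
    Tendsto f l (𝓝 c₁) := by
  refine isCompact_Icc.tendsto_nhds_of_unique_mapClusterPt hbdd ?_
  intro x _ hx
  apply h1
  refine hK.mem_of_mapClusterPt (f := fun ρ => (ρ, f ρ)) ?_ hf
  rw [mapClusterPt_iff_frequently]
  intro s hs
  obtain ⟨V₁, hV₁, V₂, hV₂, hsub⟩ := mem_nhds_prod_iff.mp hs
  have e1 : ∀ᶠ ρ in l, ρ ∈ V₁ := hl hV₁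
  have e2 : ∃ᶠ ρ in l, f ρ ∈ V₂ := (mapClusterPt_iff_frequently.mp hx) V₂ hV₂
  exact (e2.and_eventually e1).mono fun ρ h => hsub (Set.mk_mem_prod h.2 h.1)

/-- DOWN-SET ⇒ ANTITONE PHASE BOUNDARY (step (D)): if on `I` the subcritical set is a
down-set in ρ (`(ρ', c) ∈ U → ρ ≤ ρ' → (ρ, c) ∈ U`, which is what the sign lemma
`∂_ρ P_n ≥ 0` gives), then `c_low ρ := sSup {c ≤ b | (ρ, c) ∈ U}` is antitone on `I`
(given one subcritical height `a` on every line, for the `sSup` to be well behaved). -/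
theorem antitoneOn_phaseBoundary_of_downset {U : Set (ℝ × ℝ)} {I : Set ℝ} {a b : ℝ}
    (hab : a ≤ b) (hbot : ∀ ρ ∈ I, (ρ, a) ∈ U)
    (hdown : ∀ ρ ∈ I, ∀ ρ' ∈ I, ∀ c, ρ ≤ ρ' → (ρ', c) ∈ U → (ρ, c) ∈ U) :
    AntitoneOn (fun ρ => sSup {c | c ≤ b ∧ (ρ, c) ∈ U}) I := by
  intro ρ hρ ρ' hρ' hle
  have hne : ({c | c ≤ b ∧ (ρ', c) ∈ U} : Set ℝ).Nonempty := ⟨a, hab, hbot ρ' hρ'⟩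
  have hbdd : BddAbove ({c | c ≤ b ∧ (ρ, c) ∈ U} : Set ℝ) := ⟨b, fun c hc => hc.1⟩
  exact csSup_le_csSup hbdd hne fun c hc => ⟨hc.1, hdown ρ hρ ρ' hρ' c hle hc.2⟩

/-! ## 7. `M_k` is a MONOTONE block factor of a PRODUCT measure (two bits per block)

The selector/shared-coin description is not monotone in the selector, but the same block law
is the push-forward of INDEPENDENT bits under an INCREASING map: per block an "all-open" bit
`A` (probability ρ/2) and a "free" bit `B` (probability (1-ρ)/(1-ρ/2)), per sub-edge its own
fair coin `o`; sub-edge open iff `A ∨ (B ∧ o)`. Consequently crossing events of `M_k(ρ,c)` are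
increasing events of a product measure on bits with parameters (ρ/2, (1-ρ)/(1-ρ/2), ½, c):
Harris–FKG (positive association, superseding §5's lattice-condition route), BK/Reimer,
Russo's formula in every parameter, OSSS and Kesten-style RSW/arm technology apply VERBATIM,
and the non-monotonicity in ρ is exactly "p_A = ρ/2 increases while p_B = (1-ρ)/(1-ρ/2)
decreases". (The measure-level identity `M k ρ c = (bits).map cfg'` is the provers'
bookkeeping; here the single-block law identity for k = 2.) -/

/-- Sub-edge state from the bits: all-open bit, free bit, own coin. -/
def openOfBits (A B o : Bool) : Bool := A || (B && o)

/-- `openOfBits` is increasing in each bit. -/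
theorem openOfBits_mono {A A' B B' o o' : Bool} (hA : A ≤ A') (hB : B ≤ B') (ho : o ≤ o') :
    openOfBits A B o ≤ openOfBits A' B' o' := by
  revert hA hB ho; cases A <;> cases A' <;> cases B <;> cases B' <;> cases o <;> cases o' <;> decide

/-- Weight of the all-open bit. -/
noncomputable def wA (ρ : ℝ) (x : Bool) : ℝ := if x then ρ / 2 else 1 - ρ / 2
/-- Weight of the free bit. -/
noncomputable def wB (ρ : ℝ) (x : Bool) : ℝ := if x then (1 - ρ) / (1 - ρ / 2) else 1 - (1 - ρ) / (1 - ρ / 2)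
/-- Weight of an own fair coin. -/
noncomputable def wo (_x : Bool) : ℝ := 1 / 2

/-- Push-forward of the product bit law to the pair of sub-edge states (k = 2). -/
noncomputable def bitPush2 (ρ : ℝ) (a b : Bool) : ℝ :=
  ∑ A : Bool, ∑ B : Bool, ∑ o₁ : Bool, ∑ o₂ : Bool,
    wA ρ A * wB ρ B * wo o₁ * wo o₂ *
      (if openOfBits A B o₁ = a ∧ openOfBits A B o₂ = b then 1 else 0)

/-- THE MONOTONE PRODUCT ENCODING reproduces the 2-block law of `M_2(ρ,·)` (for ρ < 2, in
particular on [0,1]): `bitPush2 ρ = blockLaw2 ρ`. -/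
theorem bitPush2_eq_blockLaw2 {ρ : ℝ} (hρ : ρ < 2) (a b : Bool) :
    bitPush2 ρ a b = blockLaw2 ρ a b := by
  have h2 : (2 - ρ) ≠ 0 := by intro h; linarith
  have hq : (1 - ρ) / (1 - ρ / 2) = 2 * (1 - ρ) / (2 - ρ) := by
    rw [div_eq_div_iff (by intro h; apply h2; linarith) h2]; ring
  cases a <;> cases b <;>
    simp [bitPush2, blockLaw2, openOfBits, wA, wB, wo, hq] <;>
    field_simp <;> ring

/-! ## 8. ONE-SIDED cone ⇒ BV of the lower envelope (after crux idea `signed-cone-envelope`)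

The crux idea `Ideas/signed-cone-envelope.md` (crux-ideate r1, ideator 2; read 2026-08-16)
improves on (B)–(D) above decisively: only the NEGATIVE part of `∂_ρ P` has to be charged to
`∂_c P`, and that part is carried by the OR-classes, each of which needs an interior edge at a
midpoint doing connecting work — so `∂_ρ P ≥ -C ∂_c P` with `C = C(k)·(1-c)^{-1}`, UNIFORM in ρ
and as `c → 0` (for k = 2: the unique negative class {11,10,01}; after closing the sibling edge
the charged edge is pivotal in every tuple state ≠ 00, probability ≥ ½ whatever ρ — I checked the
state-11 case: u–m–w all on side 1 and side 1 ≁ side 2 otherwise, since 1_A(00) = 0). A one-sided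
cone makes `c⁻ - C·ρ` antitone (set-level step `antitoneOn_envelope_sub_linear_of_oneSidedCone`),
hence `c⁻` is BV WITHOUT continuity, sharpness or any sign lemma
(`boundedVariationOn_of_antitone_sub_linear`); jumps of `c⁻` are bridged by vertical segments
inside the interval fibres of K, and the endpoints by the vertical segments {1}×[0,c⁻(1⁻)],
{0}×[c⁻(0),½] — which lie in K as soon as (1,0),(0,½) ∈ K, i.e. endpoint RSW (bond-ℤ² in tree).
CONSEQUENCE FOR THIS FILE: the caution in (D) stands as a statement about TWO-sided Lipschitz
control, but the crux's BV clause has NO teeth either. What keeps teeth: the one-sided cone itself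
(k = 3 near ρ → 1 with c ≥ c₁: the ρ-uniform constant-state gadget), the primal/dual finite-size
criteria for k-dependent laws, and KST Thm 1 for kℤ²-periodic laws (printed remark, Comment 1).
Ideator's toy checks (their jobs): j005298 EXACT 4×2 box, k = 2: ∂_ρP > 0 at all 420 grid points
of [0,1]×[0,0.95]; j005680 k = 3 MC 18×9: ∂_ρP > 0 at 8 points incl. (0.97,0.06), (0.99,0.45),
negative-class part ≤ 1.5 % of ∂_cP. -/

/-- Subadditivity of the variation (not in Mathlib at the pin; cf. the tree's
`Literature.Geometry.Lorentzian.eVariationOn_add_le`, restated to avoid the import). -/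
theorem eVariationOn_add_le' {α : Type*} [LinearOrder α] (f g : α → ℝ) (s : Set α) :
    eVariationOn (f + g) s ≤ eVariationOn f s + eVariationOn g s := by
  refine iSup_le fun p => ?_
  calc ∑ i ∈ Finset.range p.1, edist ((f + g) (p.2.1 (i + 1))) ((f + g) (p.2.1 i))
      ≤ ∑ i ∈ Finset.range p.1,
          (edist (f (p.2.1 (i + 1))) (f (p.2.1 i)) + edist (g (p.2.1 (i + 1))) (g (p.2.1 i))) :=
        Finset.sum_le_sum fun i _ => edist_add_add_le _ _ _ _
    _ = (∑ i ∈ Finset.range p.1, edist (f (p.2.1 (i + 1))) (f (p.2.1 i))) +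
          ∑ i ∈ Finset.range p.1, edist (g (p.2.1 (i + 1))) (g (p.2.1 i)) :=
        Finset.sum_add_distrib
    _ ≤ eVariationOn f s + eVariationOn g s :=
        add_le_add (eVariationOn.sum_le p.2.2.1 p.2.2.2) (eVariationOn.sum_le p.2.2.1 p.2.2.2)


/-- ONE-SIDED CONE ⇒ BV: if `ρ ↦ g ρ - C ρ` is antitone on `[0,1]` (`C ≥ 0`) and `g` is bounded
there, then `g` has bounded variation on `[0,1]` — with no continuity of `g` whatsoever. -/
theorem boundedVariationOn_of_antitone_sub_linear {g : ℝ → ℝ} {C B : ℝ} (hC : 0 ≤ C)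
    (hanti : AntitoneOn (fun ρ => g ρ - C * ρ) (Icc 0 1)) (hbdd : ∀ ρ ∈ Icc (0:ℝ) 1, |g ρ| ≤ B) :
    BoundedVariationOn g (Icc 0 1) := by
  have h1 : BoundedVariationOn (fun ρ => g ρ - C * ρ) (Icc 0 1) := by
    refine antitoneOn_boundedVariationOn (C := B + C) hanti ?_
    intro ρ hρ
    have := hbdd ρ hρ
    have hCρ : |C * ρ| ≤ C := by
      rw [abs_of_nonneg (mul_nonneg hC hρ.1)]; nlinarith [hρ.2]
    calc |g ρ - C * ρ| ≤ |g ρ| + |C * ρ| := abs_sub _ _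
      _ ≤ B + C := add_le_add this hCρ
  have h2 : BoundedVariationOn (fun ρ : ℝ => C * ρ) (Icc 0 1) := by
    refine MonotoneOn.boundedVariationOn (C := C) (fun x _ y _ hxy => by nlinarith) ?_
    intro ρ hρ
    rw [abs_of_nonneg (mul_nonneg hC hρ.1)]; nlinarith [hρ.2]
  have h3 := ne_top_of_le_ne_top (ENNReal.add_ne_top.2 ⟨h1, h2⟩)
    (eVariationOn_add_le' (fun ρ => g ρ - C * ρ) (fun ρ : ℝ => C * ρ) (Icc 0 1))
  have heq : ((fun ρ => g ρ - C * ρ) + fun ρ : ℝ => C * ρ) = g := by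
    funext ρ; simp
  rwa [heq] at h3


/-- ONE-SIDED CONE AT THE SET LEVEL ⇒ `c⁻ - C·ρ` ANTITONE: if the complement of the open
subcritical set `U` is invariant under the up-right cones `(ρ, c) ↦ (ρ', c + C(ρ'-ρ))`, `ρ ≤ ρ'`,
`c ≥ 0` (which is what `∂_ρ P_n ≥ -C ∂_c P_n` gives scale by scale), and no vertical line over `I` is
subcritical at height `b ≥ 0`, then the lower envelope `c⁻ ρ := sInf {c ≥ 0 | (ρ, c) ∉ U}` has
`c⁻ - C·ρ` antitone on `I` (openness of `U` makes the infimum attained). -/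
theorem antitoneOn_envelope_sub_linear_of_oneSidedCone {U : Set (ℝ × ℝ)} (hU : IsOpen U)
    {I : Set ℝ} {C b : ℝ} (hC : 0 ≤ C) (hnonneg : 0 ≤ b) (htop : ∀ ρ ∈ I, (ρ, b) ∉ U)
    (hcone : ∀ ρ ∈ I, ∀ ρ' ∈ I, ∀ c, 0 ≤ c → ρ ≤ ρ' → (ρ, c) ∉ U → (ρ', c + C * (ρ' - ρ)) ∉ U) :
    AntitoneOn (fun ρ => sInf {c | 0 ≤ c ∧ (ρ, c) ∉ U} - C * ρ) I := by
  intro ρ hρ ρ' hρ' hle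
  have hne : ∀ r ∈ I, ({c | 0 ≤ c ∧ (r, c) ∉ U} : Set ℝ).Nonempty := fun r hr => ⟨b, hnonneg, htop r hr⟩
  have hbdd : ∀ r, BddBelow ({c | 0 ≤ c ∧ (r, c) ∉ U} : Set ℝ) := fun r => ⟨0, fun c hc => hc.1⟩
  have hclosed : ∀ r, IsClosed ({c | 0 ≤ c ∧ (r, c) ∉ U} : Set ℝ) := by
    intro r
    have h1 : IsClosed {c : ℝ | (r, c) ∉ U} := by
      have : IsOpen {c : ℝ | (r, c) ∈ U} := hU.preimage (Continuous.prodMk_right r)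
      simpa [Set.compl_setOf] using this.isClosed_compl
    exact (isClosed_Ici.inter h1 : IsClosed (Set.Ici (0:ℝ) ∩ {c : ℝ | (r, c) ∉ U}))
  -- the infimum at ρ is attained
  have hmem : sInf {c | 0 ≤ c ∧ (ρ, c) ∉ U} ∈ {c | 0 ≤ c ∧ (ρ, c) ∉ U} :=
    (hclosed ρ).csInf_mem (hne ρ hρ) (hbdd ρ)
  -- push it along the cone
  have hpush : (ρ', sInf {c | 0 ≤ c ∧ (ρ, c) ∉ U} + C * (ρ' - ρ)) ∉ U :=
    hcone ρ hρ ρ' hρ' _ hmem.1 hle hmem.2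
  show sInf {c | 0 ≤ c ∧ (ρ', c) ∉ U} - C * ρ' ≤ sInf {c | 0 ≤ c ∧ (ρ, c) ∉ U} - C * ρ
  by_cases hsign : 0 ≤ sInf {c | 0 ≤ c ∧ (ρ, c) ∉ U} + C * (ρ' - ρ)
  · have := csInf_le (hbdd ρ') ⟨hsign, hpush⟩
    linarith
  · exact absurd (add_nonneg hmem.1 (mul_nonneg hC (sub_nonneg.mpr hle))) hsign

/-! ## 9. THE ENVELOPE PATH (the soft half of the `signed-cone-envelope` line, CHECKED)

`EnvelopePath.exists_path`: if `K ⊆ [0,1]²` is closed with interval (order-connected) vertical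
fibres, contains the graph over `[0,1]` of a function `g` with `g - C·ρ` antitone (`C ≥ 0`,
`g 0 ≤ ½`), and contains `(0,½)` and `(1,0)`, then there is a continuous `γ : [0,1] → K` from
`(1,0)` to `(0,½)` with both coordinates of bounded variation. Construction: `F := (C+1)·id - g`
has unit gaps (`F ρ' - F ρ ≥ ρ' - ρ`), its generalised inverse `G t := sSup {ρ ∈ [0,1] | F ρ ≤ t}`
is monotone and 1-Lipschitz, and `t ↦ (G t, (C+1)·G t - t)` on `[-½, C+1]` traces the two endpoint
segments, the graph of `g`, and a vertical connector across every (downward) jump of `g`; each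
point is squeezed into `K` between a `K`-point above (compactness from the left, or `(0,½)`) and
one below (from the right, or `(1,0)`) using the interval fibre. `pathOK_of_envelope` then
delivers the crux's `PathOK`, and `criticalPathRSW_of_envelopes` the crux itself, from exactly:
a closed `K` with interval fibres and UNIFORM box-crossing bounds on it, a lower envelope `g`
with graph in `K` and `g - C·ρ` antitone (§8), `(0,½), (1,0) ∈ K`, `g 0 ≤ ½`. Everything soft
in the line is thereby machine-checked; what the provers owe is percolation only: the one-sided
cone, the two finite-size criteria, and RSW (KST) on `K`. -/

namespace EnvelopePath


variable {g : ℝ → ℝ} {C : ℝ}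

/-- `F ρ = (C+1)ρ - g ρ`, strictly increasing with unit gaps when `g - C·id` is antitone. -/
noncomputable def F (g : ℝ → ℝ) (C : ℝ) (ρ : ℝ) : ℝ := (C + 1) * ρ - g ρ

/-- Generalised inverse of `F` on `[0,1]`. -/
noncomputable def G (g : ℝ → ℝ) (C : ℝ) (t : ℝ) : ℝ := sSup {ρ | ρ ∈ Icc (0:ℝ) 1 ∧ F g C ρ ≤ t}

theorem F_gap (hanti : AntitoneOn (fun ρ => g ρ - C * ρ) (Icc 0 1)) {ρ ρ' : ℝ}
    (hρ : ρ ∈ Icc (0:ℝ) 1) (hρ' : ρ' ∈ Icc (0:ℝ) 1) (h : ρ ≤ ρ') :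
    F g C ρ + (ρ' - ρ) ≤ F g C ρ' := by
  have := hanti hρ hρ' h
  simp only [F]
  linarith

theorem G_mem (t : ℝ) : G g C t ∈ Icc (0:ℝ) 1 := by
  constructor
  · exact Real.sSup_nonneg (fun _ hρ => hρ.1.1)
  · exact Real.sSup_le (fun _ hρ => hρ.1.2) zero_le_one

theorem bddAbove_S (t : ℝ) : BddAbove {ρ | ρ ∈ Icc (0:ℝ) 1 ∧ F g C ρ ≤ t} :=
  ⟨1, fun _ hρ => hρ.1.2⟩

/-- below `G t` the function `F` is `≤ t` -/
theorem F_le_of_lt_G (hanti : AntitoneOn (fun ρ => g ρ - C * ρ) (Icc 0 1)) {t ρ : ℝ}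
    (hρ : ρ ∈ Icc (0:ℝ) 1) (h : ρ < G g C t) : F g C ρ ≤ t := by
  have hne : ({ρ | ρ ∈ Icc (0:ℝ) 1 ∧ F g C ρ ≤ t}).Nonempty := by
    by_contra hem
    rw [Set.not_nonempty_iff_eq_empty] at hem
    have : G g C t = 0 := by
      show sSup {ρ | ρ ∈ Icc (0:ℝ) 1 ∧ F g C ρ ≤ t} = 0
      rw [hem, Real.sSup_empty]
    rw [this] at h
    exact absurd hρ.1 (not_le.mpr h)
  obtain ⟨ρ', hρ'S, hlt⟩ := exists_lt_of_lt_csSup hne h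
  have := F_gap hanti hρ hρ'S.1 hlt.le
  linarith [hρ'S.2]

/-- above `G t` the function `F` is `> t` -/
theorem lt_F_of_G_lt {t ρ : ℝ} (hρ : ρ ∈ Icc (0:ℝ) 1) (h : G g C t < ρ) : t < F g C ρ := by
  by_contra hle
  have : ρ ≤ G g C t := le_csSup (bddAbove_S t) ⟨hρ, not_lt.mp hle⟩
  linarith

theorem G_mono : Monotone (G g C) := by
  intro t t' htt'
  by_cases hne : ({ρ | ρ ∈ Icc (0:ℝ) 1 ∧ F g C ρ ≤ t}).Nonempty
  · exact csSup_le_csSup (bddAbove_S t') hne (fun _ hρ => ⟨hρ.1, hρ.2.trans htt'⟩)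
  · rw [Set.not_nonempty_iff_eq_empty] at hne
    have : G g C t = 0 := by
      show sSup {ρ | ρ ∈ Icc (0:ℝ) 1 ∧ F g C ρ ≤ t} = 0
      rw [hne, Real.sSup_empty]
    rw [this]; exact (G_mem t').1

/-- `G` is 1-Lipschitz (unit gaps of `F`). -/
theorem G_sub_le (hanti : AntitoneOn (fun ρ => g ρ - C * ρ) (Icc 0 1)) {t t' : ℝ} (htt' : t ≤ t') :
    G g C t' ≤ G g C t + (t' - t) := by
  by_contra hlt
  have hlt := lt_of_not_ge hlt
  -- pick ρ with G t + (t'-t) < ρ < G t'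
  obtain ⟨ρ, hρ1, hρ2⟩ := exists_between hlt
  -- pick ρ₁ with G t < ρ₁ < ρ - (t'-t)
  have hgap : G g C t < ρ - (t' - t) := by linarith
  obtain ⟨ρ₁, hρ₁1, hρ₁2⟩ := exists_between hgap
  have hGt := G_mem (g := g) (C := C) t
  have hGt' := G_mem (g := g) (C := C) t'
  have hρI : ρ ∈ Icc (0:ℝ) 1 := ⟨by linarith [hGt.1], by linarith [hGt'.2]⟩
  have hρ₁I : ρ₁ ∈ Icc (0:ℝ) 1 := ⟨by linarith [hGt.1], by linarith [hGt'.2]⟩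
  have h1 : t < F g C ρ₁ := lt_F_of_G_lt hρ₁I hρ₁1
  have h2 : F g C ρ ≤ t' := F_le_of_lt_G hanti hρI hρ2
  have h3 := F_gap hanti hρ₁I hρI (by linarith)
  linarith

theorem G_lipschitz (hanti : AntitoneOn (fun ρ => g ρ - C * ρ) (Icc 0 1)) :
    LipschitzWith 1 (G g C) := by
  refine LipschitzWith.of_dist_le_mul fun t t' => ?_
  rw [NNReal.coe_one, one_mul, Real.dist_eq, Real.dist_eq, abs_sub_le_iff]
  rcases le_total t t' with h | h
  · have a := G_sub_le hanti h
    have b := G_mono (g := g) (C := C) h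
    rw [abs_of_nonpos (by linarith)]
    constructor <;> linarith
  · have a := G_sub_le hanti h
    have b := G_mono (g := g) (C := C) h
    rw [abs_of_nonneg (by linarith)]
    constructor <;> linarith

/-- the envelope path point at parameter `t` -/
noncomputable def pt (g : ℝ → ℝ) (C : ℝ) (t : ℝ) : ℝ × ℝ := (G g C t, (C + 1) * G g C t - t)

variable {K : Set (ℝ × ℝ)}

/-- every point of the envelope path lies in `K` (closedness + interval fibres) -/
theorem pt_mem (hK : IsClosed K) (hKsub : K ⊆ Icc 0 1 ×ˢ Icc 0 1)
    (hfib : ∀ ρ, Set.OrdConnected {c | (ρ, c) ∈ K})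
    (hg : ∀ ρ ∈ Icc (0:ℝ) 1, (ρ, g ρ) ∈ K) (hanti : AntitoneOn (fun ρ => g ρ - C * ρ) (Icc 0 1))
    (h0 : ((0:ℝ), (1/2:ℝ)) ∈ K) (h1 : ((1:ℝ), (0:ℝ)) ∈ K)
    {t : ℝ} (ht : t ∈ Icc (-1/2 : ℝ) (C + 1)) : pt g C t ∈ K := by
  have hρ₀ : G g C t ∈ Icc (0:ℝ) 1 := G_mem t
  set ρ₀ := G g C t with hρ₀def
  -- a point of K above
  have hup : ∃ yhi, (C + 1) * ρ₀ - t ≤ yhi ∧ (ρ₀, yhi) ∈ K := by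
    rcases eq_or_lt_of_le hρ₀.1 with h0eq | hpos
    · refine ⟨1 / 2, ?_, ?_⟩
      · rw [← h0eq]; linarith [ht.1]
      · rw [← h0eq]; exact h0
    · let A := K ∩ {p : ℝ × ℝ | p.1 ≤ ρ₀ ∧ (C + 1) * p.1 - t ≤ p.2}
      have hAcl : IsClosed {p : ℝ × ℝ | p.1 ≤ ρ₀ ∧ (C + 1) * p.1 - t ≤ p.2} :=
        (isClosed_le continuous_fst continuous_const).inter
          (isClosed_le (by fun_prop) continuous_snd)
      have hAc : IsCompact A :=
        (isCompact_Icc.prod isCompact_Icc).of_isClosed_subset (hK.inter hAcl)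
          (Set.inter_subset_left.trans hKsub)
      have himg : IsClosed (Prod.fst '' A) := (hAc.image continuous_fst).isClosed
      have hsub : Ico 0 ρ₀ ⊆ Prod.fst '' A := by
        intro ρ hρ
        have hρI : ρ ∈ Icc (0:ℝ) 1 := ⟨hρ.1, hρ.2.le.trans hρ₀.2⟩
        have hF : F g C ρ ≤ t := F_le_of_lt_G hanti hρI hρ.2
        refine ⟨(ρ, g ρ), ⟨hg ρ hρI, hρ.2.le, ?_⟩, rfl⟩
        simp only [F] at hF
        show (C + 1) * ρ - t ≤ g ρ
        linarith
      have hmem : ρ₀ ∈ Prod.fst '' A := by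
        have hcl : ρ₀ ∈ closure (Ico 0 ρ₀) := by
          rw [closure_Ico hpos.ne]; exact right_mem_Icc.mpr hpos.le
        exact closure_minimal hsub himg hcl
      obtain ⟨p, hpA, hp1⟩ := hmem
      refine ⟨p.2, ?_, ?_⟩
      · have := hpA.2.2; rw [hp1] at this; exact this
      · have : (p.1, p.2) ∈ K := hpA.1
        rwa [hp1] at this
  -- a point of K below
  have hlo : ∃ ylo, ylo ≤ (C + 1) * ρ₀ - t ∧ (ρ₀, ylo) ∈ K := by
    rcases eq_or_lt_of_le hρ₀.2 with h1eq | hlt1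
    · refine ⟨0, ?_, ?_⟩
      · rw [h1eq]; linarith [ht.2]
      · rw [h1eq]; exact h1
    · let A := K ∩ {p : ℝ × ℝ | ρ₀ ≤ p.1 ∧ p.2 ≤ (C + 1) * p.1 - t}
      have hAcl : IsClosed {p : ℝ × ℝ | ρ₀ ≤ p.1 ∧ p.2 ≤ (C + 1) * p.1 - t} :=
        (isClosed_le continuous_const continuous_fst).inter
          (isClosed_le continuous_snd (by fun_prop))
      have hAc : IsCompact A :=
        (isCompact_Icc.prod isCompact_Icc).of_isClosed_subset (hK.inter hAcl)
          (Set.inter_subset_left.trans hKsub)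
      have himg : IsClosed (Prod.fst '' A) := (hAc.image continuous_fst).isClosed
      have hsub : Ioc ρ₀ 1 ⊆ Prod.fst '' A := by
        intro ρ hρ
        have hρI : ρ ∈ Icc (0:ℝ) 1 := ⟨hρ₀.1.trans hρ.1.le, hρ.2⟩
        have hF : t < F g C ρ := lt_F_of_G_lt hρI hρ.1
        refine ⟨(ρ, g ρ), ⟨hg ρ hρI, hρ.1.le, ?_⟩, rfl⟩
        simp only [F] at hF
        show g ρ ≤ (C + 1) * ρ - t
        linarith
      have hmem : ρ₀ ∈ Prod.fst '' A := by
        have hcl : ρ₀ ∈ closure (Ioc ρ₀ 1) := by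
          rw [closure_Ioc hlt1.ne]; exact left_mem_Icc.mpr hlt1.le
        exact closure_minimal hsub himg hcl
      obtain ⟨p, hpA, hp1⟩ := hmem
      refine ⟨p.2, ?_, ?_⟩
      · have := hpA.2.2; rw [hp1] at this; exact this
      · have : (p.1, p.2) ∈ K := hpA.1
        rwa [hp1] at this
  obtain ⟨yhi, hyhi, hKhi⟩ := hup
  obtain ⟨ylo, hylo, hKlo⟩ := hlo
  exact (hfib ρ₀).out hKlo hKhi ⟨hylo, hyhi⟩

/-- THE ENVELOPE PATH. If `K ⊆ [0,1]²` is closed with interval (order-connected) fibres, contains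
the graph of `g` over `[0,1]` where `g - C·id` is antitone (`C ≥ 0`), contains `(0,½)` and `(1,0)`,
and `g 0 ≤ ½`, then there is a continuous path `γ : [0,1] → K` from `(1,0)` to `(0,½)` whose two
coordinates have bounded variation: `γ` runs down `{1}×[0,g 1]`… in reverse: it is the completed
graph of `g` (jumps bridged vertically) followed/preceded by the two endpoint segments,
parametrised through the 1-Lipschitz generalised inverse `G` of `F = (C+1)·id - g`. -/
theorem exists_path (hK : IsClosed K) (hKsub : K ⊆ Icc 0 1 ×ˢ Icc 0 1)
    (hfib : ∀ ρ, Set.OrdConnected {c | (ρ, c) ∈ K})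
    (hg : ∀ ρ ∈ Icc (0:ℝ) 1, (ρ, g ρ) ∈ K) (hC : 0 ≤ C)
    (hanti : AntitoneOn (fun ρ => g ρ - C * ρ) (Icc 0 1)) (hg0 : g 0 ≤ 1 / 2)
    (h0 : ((0:ℝ), (1/2:ℝ)) ∈ K) (h1 : ((1:ℝ), (0:ℝ)) ∈ K) :
    ∃ γ : unitInterval → ℝ × ℝ, Continuous γ ∧ γ 0 = (1, 0) ∧ γ 1 = (0, 1 / 2) ∧ (∀ s, γ s ∈ K) ∧
      BoundedVariationOn (fun s => (γ s).1) Set.univ ∧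
      BoundedVariationOn (fun s => (γ s).2) Set.univ := by
  -- parameter change `τ s = (C+1) - (C + 3/2) s` from [0,1] onto [-1/2, C+1], decreasing
  let τ : unitInterval → ℝ := fun s => (C + 1) - (C + 3 / 2) * (s : ℝ)
  have hτmem : ∀ s : unitInterval, τ s ∈ Icc (-1/2 : ℝ) (C + 1) := by
    intro s
    have h0 := s.2.1; have h1 := s.2.2
    constructor <;> simp only [τ] <;> nlinarith
  have hτanti : ∀ s s' : unitInterval, s ≤ s' → τ s' ≤ τ s := by
    intro s s' h
    have : (s : ℝ) ≤ (s' : ℝ) := h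
    simp only [τ]; nlinarith
  have hg1 : 0 ≤ g 1 := (hKsub (hg 1 ⟨zero_le_one, le_rfl⟩)).2.1
  -- G at the two ends
  have hGtop : G g C (C + 1) = 1 := by
    refine le_antisymm (G_mem _).2 ?_
    refine le_csSup (bddAbove_S _) ⟨⟨zero_le_one, le_rfl⟩, ?_⟩
    simp only [F]; linarith
  have hGbot : G g C (-1 / 2) = 0 := by
    refine le_antisymm ?_ (G_mem _).1
    refine Real.sSup_le (fun ρ hρ => ?_) le_rfl
    have hgap := F_gap hanti ⟨le_rfl, zero_le_one⟩ hρ.1 hρ.1.1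
    have hF0 : F g C 0 = - g 0 := by simp [F]
    linarith [hρ.2]
  refine ⟨fun s => pt g C (τ s), ?_, ?_, ?_, ?_, ?_, ?_⟩
  · -- continuity
    have hτc : Continuous τ := by fun_prop
    have hGc : Continuous (G g C) := (G_lipschitz hanti).continuous
    show Continuous fun s => (G g C (τ s), (C + 1) * G g C (τ s) - τ s)
    fun_prop
  · -- γ 0 = (1, 0)
    show (G g C (τ 0), (C + 1) * G g C (τ 0) - τ 0) = (1, 0)
    have : τ 0 = C + 1 := by simp [τ]
    rw [this, hGtop]; ext <;> simp
  · -- γ 1 = (0, 1/2)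
    show (G g C (τ 1), (C + 1) * G g C (τ 1) - τ 1) = (0, 1 / 2)
    have : τ 1 = -1 / 2 := by simp [τ]; ring
    rw [this, hGbot]; ext <;> simp; ring
  · intro s
    exact pt_mem hK hKsub hfib hg hanti h0 h1 (hτmem s)
  · -- BV of the first coordinate: antitone and bounded
    refine antitoneOn_boundedVariationOn (C := 1) (fun s _ s' _ h => G_mono (hτanti s s' h)) ?_
    intro s _
    have hm := G_mem (g := g) (C := C) (τ s)
    show |G g C (τ s)| ≤ 1
    rw [abs_of_nonneg hm.1]; exact hm.2
  · -- BV of the second coordinate: antitone part + monotone affine part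
    have hsplit : (fun s : unitInterval => (pt g C (τ s)).2) =
        (fun s : unitInterval => (C + 1) * G g C (τ s)) + fun s : unitInterval => (C + 3 / 2) * (s : ℝ) - (C + 1) := by
      funext s; simp only [pt, τ, Pi.add_apply]; ring
    rw [hsplit]
    have hA : BoundedVariationOn (fun s : unitInterval => (C + 1) * G g C (τ s)) Set.univ := by
      refine antitoneOn_boundedVariationOn (C := C + 1) ?_ ?_
      · intro s _ s' _ h
        exact mul_le_mul_of_nonneg_left (G_mono (hτanti s s' h)) (by linarith)
      · intro s _
        have hm := G_mem (g := g) (C := C) (τ s)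
        rw [abs_of_nonneg (mul_nonneg (by linarith) hm.1)]
        nlinarith [hm.2]
    have hB : BoundedVariationOn (fun s : unitInterval => (C + 3 / 2) * (s : ℝ) - (C + 1)) Set.univ := by
      refine MonotoneOn.boundedVariationOn (C := 2 * C + 3) ?_ ?_
      · intro s _ s' _ h
        have : (s : ℝ) ≤ (s' : ℝ) := h
        nlinarith
      · intro s _
        have h0 := s.2.1; have h1 := s.2.2
        rw [abs_le]; constructor <;> nlinarith
    exact ne_top_of_le_ne_top (ENNReal.add_ne_top.2 ⟨hA, hB⟩) (eVariationOn_add_le' _ _ _)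


end EnvelopePath

/-- From an envelope inside a closed critical set with interval fibres and UNIFORM box-crossing
bounds to the crux's path requirements (`PathOK`). -/
theorem pathOK_of_envelope (μ : ℝ → ℝ → Measure (BondConfig (Site 2))) {K : Set (ℝ × ℝ)}
    (hK : IsClosed K) (hKsub : K ⊆ Set.Icc 0 1 ×ˢ Set.Icc 0 1)
    (hfib : ∀ ρ, Set.OrdConnected {c | (ρ, c) ∈ K})
    (hRSW : ∀ a : ℝ, 0 < a → ∃ c₀ > 0, ∃ n₀ : ℕ, ∀ p ∈ K,
      BoxCrossingBounds (μ p.1 p.2) squareLatticeEmbedding.z a c₀ n₀)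
    {g : ℝ → ℝ} (hg : ∀ ρ ∈ Set.Icc (0:ℝ) 1, (ρ, g ρ) ∈ K) {C : ℝ} (hC : 0 ≤ C)
    (hanti : AntitoneOn (fun ρ => g ρ - C * ρ) (Set.Icc 0 1)) (hg0 : g 0 ≤ 1 / 2)
    (h0 : ((0:ℝ), (1/2:ℝ)) ∈ K) (h1 : ((1:ℝ), (0:ℝ)) ∈ K) :
    ∃ γ : unitInterval → ℝ × ℝ, PathOK μ γ := by
  obtain ⟨γ, hc, hγ0, hγ1, hmem, hbv1, hbv2⟩ :=
    EnvelopePath.exists_path hK hKsub hfib hg hC hanti hg0 h0 h1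
  refine ⟨γ, hc, hγ0, hγ1, fun s => hKsub (hmem s), hbv1, hbv2, ?_⟩
  intro a ha
  obtain ⟨c₀, hc₀, n₀, H⟩ := hRSW a ha
  exact ⟨c₀, hc₀, n₀, fun s => H _ (hmem s)⟩

/-- THE PROVERS' TARGET SHAPE (signed-cone-envelope line): for k = 2, 3 a closed critical set
`K ⊆ [0,1]²` of `M_k` with interval fibres and uniform box-crossing bounds, containing `(0,½)`,
`(1,0)` and the graph of a lower envelope `g` with `g - C·ρ` antitone and `g 0 ≤ ½`, proves
`CriticalPathRSW`. -/
theorem criticalPathRSW_of_envelopes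
    (h : ∀ k : ℕ, k = 2 ∨ k = 3 → ∃ K : Set (ℝ × ℝ), IsClosed K ∧ K ⊆ Set.Icc 0 1 ×ˢ Set.Icc 0 1 ∧
      (∀ ρ, Set.OrdConnected {c | (ρ, c) ∈ K}) ∧
      (∀ a : ℝ, 0 < a → ∃ c₀ > 0, ∃ n₀ : ℕ, ∀ p ∈ K,
        BoxCrossingBounds (M k p.1 p.2) squareLatticeEmbedding.z a c₀ n₀) ∧
      ((0:ℝ), (1/2:ℝ)) ∈ K ∧ ((1:ℝ), (0:ℝ)) ∈ K ∧
      ∃ g : ℝ → ℝ, ∃ C : ℝ, 0 ≤ C ∧ (∀ ρ ∈ Set.Icc (0:ℝ) 1, (ρ, g ρ) ∈ K) ∧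
        AntitoneOn (fun ρ => g ρ - C * ρ) (Set.Icc 0 1) ∧ g 0 ≤ 1 / 2) :
    CriticalPathRSW := by
  rw [criticalPathRSW_iff]
  intro k hk
  obtain ⟨K, hK, hKsub, hfib, hRSW, h0, h1, g, C, hC, hg, hanti, hg0⟩ := h k hk
  exact pathOK_of_envelope (M k) hK hKsub hfib hRSW hg hC hanti hg0 h0 h1

/-! ## 10. From the two OPEN PHASE SETS to the crux (assembly of §8–§9)

`criticalPathRSW_of_phases`: the provers' obligations stated on the subcritical set `U` and the
supercritical set `V` directly — both open, disjoint, `U` a down-set and `V` an up-set in `c`,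
the top edge not subcritical and the bottom edge not supercritical, `(0,½) ∉ U ∪ V`,
`(1,0) ∉ U`, a ONE-SIDED cone for `U` (`(ρ,c) ∉ U ⇒ (ρ', c + C(ρ'-ρ)) ∉ U` for `ρ ≤ ρ'`, `c ≥ 0`), and
UNIFORM box-crossing bounds on `K := [0,1]² ∖ (U ∪ V)`. Then `K` is closed with interval fibres,
the lower envelope `c⁻ = PhaseSets.cminus U` has its graph in `K` (openness of `V` + disjointness:
just below the envelope everything is in `U`) and `c⁻ - Cρ` antitone (§8), and §9 gives the path. -/

namespace PhaseSets


variable {U V : Set (ℝ × ℝ)}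

/-- lower envelope of the non-subcritical set -/
noncomputable def cminus (U : Set (ℝ × ℝ)) (ρ : ℝ) : ℝ := sInf {c | 0 ≤ c ∧ (ρ, c) ∉ U}

theorem cminus_spec (hU : IsOpen U) {ρ : ℝ} (htop : (ρ, (1:ℝ)) ∉ U) :
    0 ≤ cminus U ρ ∧ (ρ, cminus U ρ) ∉ U ∧ cminus U ρ ≤ 1 := by
  have hne : ({c | 0 ≤ c ∧ (ρ, c) ∉ U} : Set ℝ).Nonempty := ⟨1, zero_le_one, htop⟩
  have hbdd : BddBelow ({c | 0 ≤ c ∧ (ρ, c) ∉ U} : Set ℝ) := ⟨0, fun _ hc => hc.1⟩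
  have hclosed : IsClosed ({c | 0 ≤ c ∧ (ρ, c) ∉ U} : Set ℝ) := by
    have h1 : IsClosed {c : ℝ | (ρ, c) ∉ U} := by
      have : IsOpen {c : ℝ | (ρ, c) ∈ U} := hU.preimage (Continuous.prodMk_right ρ)
      simpa [Set.compl_setOf] using this.isClosed_compl
    exact (isClosed_Ici.inter h1 : IsClosed (Set.Ici (0 : ℝ) ∩ {c : ℝ | (ρ, c) ∉ U}))
  have hmem := hclosed.csInf_mem hne hbdd
  exact ⟨hmem.1, hmem.2, csInf_le hbdd ⟨zero_le_one, htop⟩⟩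

/-- below the envelope everything is subcritical -/
theorem mem_U_of_lt_cminus {ρ c : ℝ} (hc : 0 ≤ c) (hlt : c < cminus U ρ) : (ρ, c) ∈ U := by
  by_contra h
  have : cminus U ρ ≤ c := csInf_le ⟨0, fun _ hc => hc.1⟩ ⟨hc, h⟩
  linarith

/-- the graph of the envelope lies in the critical set `[0,1]² ∖ (U ∪ V)` -/
theorem graph_mem (hU : IsOpen U) (hV : IsOpen V) (hUV : Disjoint U V)
    (htop : ∀ ρ ∈ Icc (0:ℝ) 1, (ρ, (1:ℝ)) ∉ U) (hbot : ∀ ρ ∈ Icc (0:ℝ) 1, (ρ, (0:ℝ)) ∉ V)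
    {ρ : ℝ} (hρ : ρ ∈ Icc (0:ℝ) 1) :
    (ρ, cminus U ρ) ∈ (Icc (0:ℝ) 1 ×ˢ Icc (0:ℝ) 1) \ (U ∪ V) := by
  obtain ⟨h0, hnU, h1⟩ := cminus_spec hU (htop ρ hρ)
  refine ⟨⟨hρ, h0, h1⟩, ?_⟩
  rintro (hU' | hV')
  · exact hnU hU'
  · -- V open: a small ball around the point is in V; a point slightly below is in U unless cminus = 0
    rcases eq_or_lt_of_le h0 with hz | hpos
    · rw [← hz] at hV'; exact hbot ρ hρ hV'
    · obtain ⟨ε, hε, hball⟩ := Metric.isOpen_iff.mp hV _ hV'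
      set c' := cminus U ρ - min (ε / 2) (cminus U ρ / 2) with hc'
      have hmin_pos : 0 < min (ε / 2) (cminus U ρ / 2) := lt_min (by linarith) (by linarith)
      have hmin_le : min (ε / 2) (cminus U ρ / 2) ≤ ε / 2 := min_le_left _ _
      have hmin_le' : min (ε / 2) (cminus U ρ / 2) ≤ cminus U ρ / 2 := min_le_right _ _
      have hc'0 : 0 ≤ c' := by rw [hc']; linarith
      have hc'lt : c' < cminus U ρ := by rw [hc']; linarith
      have hc'U : (ρ, c') ∈ U := mem_U_of_lt_cminus hc'0 hc'lt
      have hc'V : (ρ, c') ∈ V := by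
        apply hball
        rw [Metric.mem_ball, Prod.dist_eq, Real.dist_eq, Real.dist_eq]
        simp only [sub_self, abs_zero]
        rw [max_eq_right (abs_nonneg _), hc']
        rw [show cminus U ρ - min (ε / 2) (cminus U ρ / 2) - cminus U ρ = -(min (ε / 2) (cminus U ρ / 2)) by ring,
          abs_neg, abs_of_pos hmin_pos]
        linarith
      exact (Set.disjoint_left.mp hUV) hc'U hc'V

/-- fibres of the critical set are intervals -/
theorem ordConnected_fibre (hUdown : ∀ ρ c c', (ρ, c) ∈ U → c' ≤ c → (ρ, c') ∈ U)
    (hVup : ∀ ρ c c', (ρ, c) ∈ V → c ≤ c' → (ρ, c') ∈ V) (ρ : ℝ) :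
    Set.OrdConnected {c | (ρ, c) ∈ (Icc (0:ℝ) 1 ×ˢ Icc (0:ℝ) 1) \ (U ∪ V)} := by
  refine ⟨fun a ha b hb c hc => ?_⟩
  refine ⟨⟨?_, ?_⟩, ?_⟩
  · rcases ha.1 with ⟨hρ, _⟩; exact hρ
  · exact ⟨ha.1.2.1.trans hc.1, hc.2.trans hb.1.2.2⟩
  · rintro (hU' | hV')
    · exact ha.2 (Or.inl (hUdown ρ c a hU' hc.1))
    · exact hb.2 (Or.inr (hVup ρ c b hV' hc.2))

/-- the critical set is closed -/
theorem isClosed_K (hU : IsOpen U) (hV : IsOpen V) :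
    IsClosed ((Icc (0:ℝ) 1 ×ˢ Icc (0:ℝ) 1) \ (U ∪ V)) :=
  (isClosed_Icc.prod isClosed_Icc).sdiff (hU.union hV)


end PhaseSets

/-- THE PROVERS' OBLIGATIONS ON THE PHASE SETS (signed-cone-envelope line, fully assembled): for
k = 2, 3, open disjoint phase sets `U` (down-set in c), `V` (up-set in c) of `M_k` with the top
edge outside `U`, the bottom edge outside `V`, `(0,½) ∉ U ∪ V`, `(1,0) ∉ U`, a one-sided cone for
`U`, and uniform box-crossing bounds OFF `U ∪ V` prove `CriticalPathRSW`. (Percolation content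
owed: the finite-size criteria defining U, V as open sub/super-critical certificate sets and their
disjointness; the one-sided Russo cone; RSW on the complement; endpoint RSW.) -/
theorem criticalPathRSW_of_phases
    (h : ∀ k : ℕ, k = 2 ∨ k = 3 → ∃ U V : Set (ℝ × ℝ), IsOpen U ∧ IsOpen V ∧ Disjoint U V ∧
      (∀ ρ c c', (ρ, c) ∈ U → c' ≤ c → (ρ, c') ∈ U) ∧
      (∀ ρ c c', (ρ, c) ∈ V → c ≤ c' → (ρ, c') ∈ V) ∧
      (∀ ρ ∈ Set.Icc (0:ℝ) 1, (ρ, (1:ℝ)) ∉ U) ∧ (∀ ρ ∈ Set.Icc (0:ℝ) 1, (ρ, (0:ℝ)) ∉ V) ∧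
      ((0:ℝ), (1/2:ℝ)) ∉ U ∧ ((0:ℝ), (1/2:ℝ)) ∉ V ∧ ((1:ℝ), (0:ℝ)) ∉ U ∧
      (∃ C : ℝ, 0 ≤ C ∧ ∀ ρ ∈ Set.Icc (0:ℝ) 1, ∀ ρ' ∈ Set.Icc (0:ℝ) 1, ∀ c, 0 ≤ c → ρ ≤ ρ' →
        (ρ, c) ∉ U → (ρ', c + C * (ρ' - ρ)) ∉ U) ∧
      (∀ a : ℝ, 0 < a → ∃ c₀ > 0, ∃ n₀ : ℕ, ∀ p ∈ (Set.Icc (0:ℝ) 1 ×ˢ Set.Icc (0:ℝ) 1) \ (U ∪ V),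
        BoxCrossingBounds (M k p.1 p.2) squareLatticeEmbedding.z a c₀ n₀)) :
    CriticalPathRSW := by
  refine criticalPathRSW_of_envelopes fun k hk => ?_
  obtain ⟨U, V, hU, hV, hUV, hUdown, hVup, htop, hbot, h0U, h0V, h1U, ⟨C, hC, hcone⟩, hRSW⟩ := h k hk
  refine ⟨(Set.Icc (0:ℝ) 1 ×ˢ Set.Icc (0:ℝ) 1) \ (U ∪ V), PhaseSets.isClosed_K hU hV,
    (fun p hp => hp.1), PhaseSets.ordConnected_fibre hUdown hVup, hRSW, ?_, ?_,
    PhaseSets.cminus U, C, hC, fun ρ hρ => PhaseSets.graph_mem hU hV hUV htop hbot hρ, ?_, ?_⟩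
  · exact ⟨⟨⟨le_rfl, zero_le_one⟩, by norm_num, by norm_num⟩, fun h' => h'.elim h0U h0V⟩
  · exact ⟨⟨⟨zero_le_one, le_rfl⟩, le_rfl, zero_le_one⟩,
      fun h' => h'.elim h1U (hbot 1 ⟨zero_le_one, le_rfl⟩)⟩
  · exact antitoneOn_envelope_sub_linear_of_oneSidedCone hU hC zero_le_one htop hcone
  · exact csInf_le ⟨0, fun _ hc => hc.1⟩ ⟨by norm_num, h0U⟩

end Summit.CriticalPhenomena.CardyFormulaZ2.Cruxes.CriticalPathRSW.Disproof
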